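import Literature.Computability.QuantumComplexity.StabilizerSimulationProofs
import Literature.Computability.QuantumComplexity.CliffordSimulator
import HarnessLib

/-!
# Gadgetization: `χ(U|y⟩) ≤ χ(|T⟩^{⊗t})` for Clifford+`T` circuits (Bravyi–Gosset; Bravyi et al.)

Topic `Literature/Computability/QuantumComplexity`. This file discharges the named fact
`BravyiGosset2016_stabilizerRank_output_le` of `StabilizerSimulation.lean`:

* `BravyiGosset2016_stabilizerRank_output_le_holds` — for an oracle-free Clifford+`T` circuit `U`
  on `N` wires with `t` `T`-gates and a computational basis state `|y⟩`,
  `χ(U|y⟩) ≤ χ(|T⟩^{⊗t})` (Bravyi–Browne–Calpin–Campbell–Gosset–Howard 2019, §2.3.1, eqs.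
  (15)–(16); Bravyi–Gosset 2016, §II).

The printed argument (BBCCGH 2019, p. 9): replacing every `T` gate by a state-injection gadget and
postselecting the gadget measurements on `0` gives
`U|0ⁿ⟩ = 2^{t/2} (1 ⊗ ⟨0^{⊗t}|) C (|0ⁿ⟩ ⊗ |T⟩^{⊗t})` with `C` Clifford (eq. (16)); "starting from an
exact stabilizer decomposition of `|Ψ⟩`, we can apply `(1 ⊗ ⟨0^{⊗t}|) C` to each stabilizer state in
the decomposition and renormalize to obtain an exact stabilizer decomposition of the output state".
The step left implicit there — *a Clifford circuit followed by the postselection `1 ⊗ ⟨0^{⊗t}|` maps a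
stabilizer state to a (possibly zero) multiple of a stabilizer state* — is the Gottesman–Knill
measurement rule; over the tree's **operational** definition of stabilizer states
(`stabilizerStates n` = the orbit of `|0ⁿ⟩` under the monoid generated by placed `H`, `S`, `CNOT`,
`StabilizerRank.lean`; no stabilizer-group formalism exists in the tree or in Mathlib) it is proved
here from scratch, in the Heisenberg picture.

## Contents (namespace `Literature.Computability.QuantumComplexity.StabilizerFormalism`)

* **Pauli operators** `pauliOp a b = X^a Z^b` on `n` qubits as monomial matrices
  (`|w⟩ ↦ (-1)^{b·w} |w ⊕ a⟩`), the sign `sgn b w = (-1)^{b·w}`, the product formula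
  `(X^a Z^b)(X^{a'} Z^{b'}) = (-1)^{b·a'} X^{a⊕a'} Z^{b⊕b'}` (`pauliOp_mul`).
* **The Clifford generators as Pauli combinations** — `H_j = (X_j + Z_j)/√2`,
  `S_j = ((1+i) + (1-i)Z_j)/2`, `CNOT = (1 + Z_c + X_t - X_t Z_c)/2` — and hence the **conjugation
  rules** `H_j (X^a Z^b) = ± (X^{a'} Z^{b'}) H_j`, `S_j (X^a Z^b) = i^{a_j} (…) S_j`,
  `CNOT (X^a Z^b) = (…) CNOT` (`hGate_mul_pauliOp`, `sGate_mul_pauliOp`, `cnot_mul_pauliOp`: the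
  update rules of Aaronson–Gottesman 2004, §III, in the `X^a Z^b` convention); by closure induction
  every Clifford circuit `W` pushes and pulls signed Paulis, `W (i^k X^a Z^b) = (i^{k'} X^{a'} Z^{b'}) W`
  (`pushesPauli_and_pullsPauli_of_mem`), and is invertible inside the Clifford monoid
  (`exists_inverse_of_mem_cliffordCircuits`; `H² = 1`, `S⁴ = 1`, `CNOT² = 1`).
* **GHZ lemma** `exists_clifford_ghz`: `(|0ⁿ⟩ + i^k |a⟩)/√2 = V|0ⁿ⟩` with
  `V = (∏ CNOT_{j→l}) S_j^k H_j` Clifford (`a ≠ 0`); hence the **Pauli projection rule**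
  `exists_smul_stabilizer_of_pauliProj`: `Ψ + (i^k X^a Z^b)Ψ` is a scaled stabilizer state for every
  stabilizer state `Ψ` (push the Pauli through `W`, act on `|0ⁿ⟩`, apply the GHZ lemma).
* **Removing postselected qubits** `exists_smul_stabilizer_projZ`: for a stabilizer state `Φ` on
  `m + t` qubits, `(1 ⊗ ⟨0^t|)Φ` (`projZ t Φ = x ↦ Φ(x, 0^t)`) is a scaled stabilizer state on `m`
  qubits. Core case (`exists_smul_stabilizer_projZ_of_vanishing`, one qubit already in `|0⟩`): the
  conjugated stabilizers `h̃_i = W Z_i W⁻¹` of `Φ = W|0^{m+1}⟩` have no `X` on the last qubit, so they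
  restrict to commuting signed Pauli involutions `h_i` on `m` qubits fixing `Φ(·,0)`; the common
  fixed space of the `h_i` is the line of `Φ(·,0)` (transport `Θ ⊗ |0⟩` back to `|0^{m+1}⟩` through
  `W⁻¹`), and it contains the nonzero scaled stabilizer state `∏ᵢ (1 + h_i)|z⟩` for a suitable basis
  state `z` (iterated Pauli projections). The general one-qubit case first applies the projection
  `1 + Z_{last}`; then induction on `t`.
* **The magic-state gadget** `projZ_cnot_mulVec_tensorVec_magicT`:
  `(1 ⊗ ⟨0|) CNOT_{q→a} (Ψ ⊗ |T⟩_a) = T_q Ψ / √2` (BBCCGH 2019, eq. (15) with `V = T`), and the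
  **gadgetization** `gadgetize` of an oracle-free gate list by induction (eq. (16)):
  `U ψ = c · (1 ⊗ ⟨0^t|) C (ψ ⊗ |T⟩^{⊗t})` with `C` Clifford on `N + t` wires.
* The discharge: insert a `χ`-term stabilizer decomposition of `|T⟩^{⊗t}`
  (`exists_stabilizerDecomposition`), use bilinearity, `tensorVec_mem_stabilizerStates`,
  `mulVec_mem_stabilizerStates` and the removal lemma term by term (`stabilizerRank_le_card`).

## Tree reuse

`StabilizerSimulationProofs.lean` (`tensorVec_*`, `placeGate_mem_cliffordCircuits`,
`placeGate_castAddEmb_mulVec_tensorVec`, `tensorVec_mem_stabilizerStates`,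
`basisState_mem_stabilizerStates`, `stabilizerRank_le_card`, `exists_stabilizerDecomposition`),
`CliffordSimulator.lean` (`CliffordSim.magicT_apply`), `LightConeAmp.lean`
(`LightCone.placeGate_wireEmb_mulVec_apply`, `LightCone.mulVec_apply_of_perm`),
`CliffordTPathSums.lean` (`emb_one_eq_wireEmb`, `emb_two_eq_pairEmb`), `ReversibleCliffordT.lean`
(`sOn/cnotOn…_mulVec_basisState`, `hOn_mul_hOn`, `mulVec_basisState`), `BQPProofs.lean` (`wireEmb`,
`hOn`, `invSqrt2`), `ControlledHadamard.lean` (`eq_sum_smul_basisState`), `CircuitEmbedding.lean`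
(`placeGate_placeGate`); Mathlib: `Submonoid.closure_induction`, `Fin.append*`, `Fin.appendEquiv`,
`Fin.prod_univ_add`, `Matrix.mulVec_*`, `Complex.I_*`.

## References

* S. Bravyi, D. Browne, P. Calpin, E. Campbell, D. Gosset, M. Howard, *Simulation of quantum
  circuits by low-rank stabilizer decompositions*, Quantum 3 (2019) 181, arXiv:1808.00128: §2.3.1
  "Gadget-based methods", eq. (15) (`V|ψ⟩ = 2^{t/2}(1 ⊗ ⟨0^{⊗t}|) C′|ψ⟩|V⟩`, `C′ = ∏ CNOT_{a,a+t}`),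
  eq. (16) (`U|0ⁿ⟩ = 2^{τ/2}(1 ⊗ ⟨0^{⊗τ}|) C|0ⁿ⟩|Ψ⟩`) and the following paragraph (read via
  `lit read arxiv:1808.00128`, pp. 8–9).
* S. Bravyi, D. Gosset, *Improved classical simulation of quantum circuits dominated by Clifford
  gates*, Phys. Rev. Lett. 116 (2016) 250501, arXiv:1601.07601, §II (gadgetization).
* S. Aaronson, D. Gottesman, *Improved simulation of stabilizer circuits*, Phys. Rev. A 70 (2004)
  052328, arXiv:quant-ph/0406196, §III (update rules of the tableau for `CNOT`, `H`, `S`, and the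
  measurement of a qubit in the standard basis).
* M. A. Nielsen, I. L. Chuang, *Quantum Computation and Quantum Information*, CUP 2010, §4.2–4.3
  (the gates), §10.5.1–10.5.3 (stabilizer formalism, measurements), §1.3.6 (Bell/GHZ preparation).

## Design notes

* Pauli strings are taken in the form `X^a Z^b` (no `i^{a·b}` normalisation); phases are tracked as
  powers `i^k`, which is all that `H`, `S`, `CNOT` generate. Everything is checked on basis states
  (`ext_of_mulVec_basisState`), so no `2 × 2` matrix algebra under `placeGate` is ever unfolded
  beyond the tree's existing one-wire/`CNOT` basis-state lemmas.
* Commutation and involutivity of the restricted stabilizers `h_i` are *not* computed from Pauli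
  algebra but transported from the conjugate representation `h̃_i = W Z_i W⁻¹` through the
  intertwining `h̃_i (Θ ⊗ |0⟩) = (h_i Θ) ⊗ |0⟩`.
* Registers on `m + t` wires are split with `Fin.append`/`Fin.castAdd`/`Fin.natAdd`, matching the
  tree's `tensorVec`; `(m + t) + 1 = m + (t + 1)` holds definitionally, which the induction uses.
-/

noncomputable section

namespace Literature.Computability.QuantumComplexity

open _root_.Computability Cryptography Matrix

namespace StabilizerFormalism

variable {n : ℕ}

/-- Pointwise XOR of two basis labels (the group law of `𝔽₂ⁿ`). [folklore] -/
def bxor (x y : QReg n) : QReg n := fun i => xor (x i) (y i)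

/-- Pointwise evaluation of `⊕`. [folklore] -/
@[simp] theorem bxor_apply (x y : QReg n) (i : Fin n) : bxor x y i = xor (x i) (y i) := rfl

/-- `⊕` is commutative. [folklore] -/
theorem bxor_comm (x y : QReg n) : bxor x y = bxor y x := by
  funext i; simp [Bool.xor_comm]

/-- `⊕` is associative. [folklore] -/
theorem bxor_assoc (x y z : QReg n) : bxor (bxor x y) z = bxor x (bxor y z) := by
  funext i; simp

/-- `x ⊕ x = 0`. [folklore] -/
@[simp] theorem bxor_self (x : QReg n) : bxor x x = fun _ => false := by
  funext i; simp

/-- `x ⊕ 0 = x`. [folklore] -/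
@[simp] theorem bxor_zero (x : QReg n) : bxor x (fun _ => false) = x := by
  funext i; simp

/-- `0 ⊕ x = x`. [folklore] -/
@[simp] theorem zero_bxor (x : QReg n) : bxor (fun _ => false) x = x := by
  funext i; simp

/-- `(x ⊕ y) ⊕ y = x`. [folklore] -/
@[simp] theorem bxor_bxor_cancel (x y : QReg n) : bxor (bxor x y) y = x := by
  funext i; simp

/-- Solving `x ⊕ y = z` for `x`. [folklore] -/
theorem bxor_eq_iff (x y z : QReg n) : bxor x y = z ↔ x = bxor z y := by
  constructor
  · rintro rfl; simp
  · rintro rfl; simp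

/-- The sign `(-1)^{b · w}` of the `Z`-part `Z^b` on the basis label `w`. [folklore] -/
def sgn (b w : QReg n) : ℂ := ∏ i, (if (b i && w i) then (-1 : ℂ) else 1)

/-- The sign `(-1)^{b·w}` is symmetric. [folklore] -/
theorem sgn_comm (b w : QReg n) : sgn b w = sgn w b := by
  unfold sgn; refine Finset.prod_congr rfl fun i _ => ?_; rw [Bool.and_comm]

/-- `(-1)^{0·w} = 1`. [folklore] -/
@[simp] theorem sgn_zero_left (w : QReg n) : sgn (fun _ => false) w = 1 := by
  simp [sgn]

/-- `(-1)^{b·0} = 1`. [folklore] -/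
@[simp] theorem sgn_zero_right (b : QReg n) : sgn b (fun _ => false) = 1 := by
  simp [sgn]

/-- `(-1)^{b·(w ⊕ w')} = (-1)^{b·w} (-1)^{b·w'}` (a character of `𝔽₂ⁿ`). [folklore] -/
theorem sgn_bxor_right (b w w' : QReg n) : sgn b (bxor w w') = sgn b w * sgn b w' := by
  unfold sgn
  rw [← Finset.prod_mul_distrib]
  refine Finset.prod_congr rfl fun i _ => ?_
  simp only [bxor_apply]
  rcases Bool.eq_false_or_eq_true (b i) with hb | hb <;>
  rcases Bool.eq_false_or_eq_true (w i) with hw | hw <;>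
  rcases Bool.eq_false_or_eq_true (w' i) with hw' | hw' <;>
  simp [hb, hw, hw']

/-- `(-1)^{(b ⊕ b')·w} = (-1)^{b·w} (-1)^{b'·w}`. [folklore] -/
theorem sgn_bxor_left (b b' w : QReg n) : sgn (bxor b b') w = sgn b w * sgn b' w := by
  rw [sgn_comm, sgn_bxor_right, sgn_comm w, sgn_comm w]

/-- `((-1)^{b·w})² = 1`. [folklore] -/
theorem sgn_mul_self (b w : QReg n) : sgn b w * sgn b w = 1 := by
  rw [← sgn_bxor_right, bxor_self, sgn_zero_right]

/-- The sign is `±1`. [folklore] -/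
theorem sgn_sq_eq_one (b w : QReg n) : sgn b w = 1 ∨ sgn b w = -1 :=
  mul_self_eq_one_iff.1 (sgn_mul_self b w)

/-- The sign is nonzero. [folklore] -/
theorem sgn_ne_zero (b w : QReg n) : sgn b w ≠ 0 := by
  rcases sgn_sq_eq_one b w with h | h <;> rw [h] <;> norm_num

/-- The sign against a single wire: `(-1)^{w j}`. [folklore] -/
theorem sgn_single_left (j : Fin n) (w : QReg n) :
    sgn (Pi.single j true) w = if w j then -1 else 1 := by
  unfold sgn
  rw [Finset.prod_eq_single j]
  · simp
  · intro i _ hij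
    simp [hij]
  · simp

/-- The sign against a single wire on the right: `(-1)^{b j}`. [folklore] -/
theorem sgn_single_right (b : QReg n) (j : Fin n) :
    sgn b (Pi.single j true) = if b j then -1 else 1 := by
  rw [sgn_comm, sgn_single_left]

/-- **The Pauli operator `X^a Z^b`** on `n` qubits (`a, b ∈ 𝔽₂ⁿ`), as the monomial matrix
`|w⟩ ↦ (-1)^{b·w} |w ⊕ a⟩`; every Pauli string is `i^k X^a Z^b` for some `k`.
[Aaronson–Gottesman 2004, §II; Nielsen–Chuang 2010, §10.5.1] [folklore] -/
def pauliOp (a b : QReg n) : Matrix (QReg n) (QReg n) ℂ :=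
  Matrix.of fun x y => if x = bxor y a then sgn b y else 0

/-- Entries of `X^a Z^b` (definitional). [folklore] -/
theorem pauliOp_apply (a b x y : QReg n) :
    pauliOp a b x y = if x = bxor y a then sgn b y else 0 := rfl

/-- `X^a Z^b |w⟩ = (-1)^{b·w} |w ⊕ a⟩`. [folklore] -/
theorem pauliOp_mulVec_basisState (a b w : QReg n) :
    pauliOp a b *ᵥ basisState w = sgn b w • basisState (bxor w a) := by
  rw [mulVec_basisState]
  funext x
  simp only [pauliOp_apply, Pi.smul_apply, basisState_apply, smul_eq_mul, mul_ite, mul_one, mul_zero]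

/-- `(X^a Z^b v)(x) = (-1)^{b·(x ⊕ a)} v(x ⊕ a)`. [folklore] -/
theorem pauliOp_mulVec_apply (a b : QReg n) (v : QReg n → ℂ) (x : QReg n) :
    (pauliOp a b *ᵥ v) x = sgn b (bxor x a) * v (bxor x a) := by
  rw [Matrix.mulVec, dotProduct, Finset.sum_eq_single (bxor x a)]
  · rw [pauliOp_apply, if_pos]; simp
  · intro y _ hy
    rw [pauliOp_apply, if_neg, zero_mul]
    intro h; exact hy (by rw [h]; simp)
  · intro h; exact absurd (Finset.mem_univ _) h

/-- `X^0 Z^0 = 1`. [folklore] -/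
@[simp] theorem pauliOp_zero_zero : pauliOp (fun _ => false) (fun _ => false) = (1 : Matrix (QReg n) (QReg n) ℂ) := by
  ext x y
  rw [pauliOp_apply, Matrix.one_apply]
  simp

/-- Two matrices agreeing on all basis states are equal. [folklore] -/
theorem ext_of_mulVec_basisState {M M' : Matrix (QReg n) (QReg n) ℂ}
    (h : ∀ w, M *ᵥ basisState w = M' *ᵥ basisState w) : M = M' := by
  ext x y
  have := congrFun (h y) x
  rwa [mulVec_basisState, mulVec_basisState] at this

/-- **Product formula**: `(X^a Z^b)(X^{a'} Z^{b'}) = (-1)^{b·a'} X^{a⊕a'} Z^{b⊕b'}`.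
[Aaronson–Gottesman 2004, §II] [folklore] -/
theorem pauliOp_mul (a b a' b' : QReg n) :
    pauliOp a b * pauliOp a' b' = sgn b a' • pauliOp (bxor a a') (bxor b b') := by
  refine ext_of_mulVec_basisState fun w => ?_
  rw [← Matrix.mulVec_mulVec, pauliOp_mulVec_basisState, Matrix.mulVec_smul, pauliOp_mulVec_basisState,
    Matrix.smul_mulVec, pauliOp_mulVec_basisState, smul_smul, smul_smul, sgn_bxor_right, sgn_bxor_left,
    bxor_assoc, bxor_comm a' a]
  congr 1
  ring

/-- `(X^a Z^b)² = (-1)^{a·b}`. [folklore] -/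
theorem pauliOp_mul_self (a b : QReg n) : pauliOp a b * pauliOp a b = sgn b a • (1 : Matrix (QReg n) (QReg n) ℂ) := by
  rw [pauliOp_mul, bxor_self, bxor_self, pauliOp_zero_zero]

/-- `Z`-type Paulis commute. [folklore] -/
theorem pauliOp_zero_mul_comm (b b' : QReg n) :
    pauliOp (fun _ => false) b * pauliOp (fun _ => false) b' = pauliOp (fun _ => false) b' * pauliOp (fun _ => false) b := by
  rw [pauliOp_mul, pauliOp_mul, sgn_zero_right, sgn_zero_right, bxor_comm b b']


/-! ### The Clifford generators as combinations of Pauli operators -/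

/-- `w ⊕ e_j` flips the bit `j`. [folklore] -/
theorem bxor_single (w : QReg n) (j : Fin n) : bxor w (Pi.single j true) = Function.update w j (!w j) := by
  funext i
  by_cases h : i = j
  · subst h; simp
  · rw [bxor_apply, Function.update_of_ne h, Pi.single_eq_of_ne h]
    exact Bool.xor_false _

/-- `x ⊕ 0 = x` for the `Zero Bool` instance (`0 = false`). [folklore] -/
@[simp] theorem xor_zero_bool (x : Bool) : (x ^^ (0 : Bool)) = x := Bool.xor_false x

/-- Updating one bit is either nothing or a flip. [folklore] -/
theorem update_eq_ite (a : QReg n) (j : Fin n) (β : Bool) :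
    Function.update a j β = if a j = β then a else bxor a (Pi.single j true) := by
  split_ifs with h
  · rw [← h, Function.update_eq_self]
  · rw [bxor_single]
    rcases Bool.eq_false_or_eq_true (a j) with h1 | h1 <;>
    rcases Bool.eq_false_or_eq_true β with h2 | h2 <;> simp_all

/-- **`H = (X + Z)/√2`** on a wire: `H_j = (X_j + Z_j)/√2`. [Nielsen–Chuang 2010, §4.2 Ex. 4.18] [folklore] -/
theorem placeGate_hGate_eq_pauli (j : Fin n) :
    placeGate (wireEmb j) hGate =
      invSqrt2 • (pauliOp (Pi.single j true) (fun _ => false) + pauliOp (fun _ => false) (Pi.single j true)) := by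
  refine ext_of_mulVec_basisState fun w => ?_
  rw [← hOn_toMatrix 0, hOn_mulVec_basisState', Matrix.smul_mulVec, Matrix.add_mulVec,
    pauliOp_mulVec_basisState, pauliOp_mulVec_basisState, sgn_zero_left, one_smul, sgn_single_left, bxor_zero,
    bxor_single]
  rcases Bool.eq_false_or_eq_true (w j) with hj | hj
  · have h1 : Function.update w j true = w := by rw [← hj, Function.update_eq_self]
    simp [hj, h1]
  · have h0 : Function.update w j false = w := by rw [← hj, Function.update_eq_self]
    simp only [hj, h0, Bool.false_eq_true, if_false, one_smul, Bool.not_false]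
    rw [add_comm]

/-- **`S = ((1+i) 1 + (1-i) Z)/2`** on a wire. [Nielsen–Chuang 2010, §4.2] [folklore] -/
theorem placeGate_sGate_eq_pauli (j : Fin n) :
    placeGate (wireEmb j) sGate =
      ((1 + Complex.I) / 2) • (1 : Matrix (QReg n) (QReg n) ℂ) +
        ((1 - Complex.I) / 2) • pauliOp (fun _ => false) (Pi.single j true) := by
  refine ext_of_mulVec_basisState fun w => ?_
  rw [← sOn_toMatrix 0, sOn_mulVec_basisState, Matrix.add_mulVec, Matrix.smul_mulVec, Matrix.smul_mulVec,
    Matrix.one_mulVec, pauliOp_mulVec_basisState, sgn_single_left, bxor_zero, smul_smul, ← add_smul]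
  congr 1
  rcases Bool.eq_false_or_eq_true (w j) with hj | hj <;> simp [hj] <;> ring

/-- **`CNOT = (1 + Z_c + X_t - X_t Z_c)/2`** (control `i`, target `j`). [Nielsen–Chuang 2010, §4.3] [folklore] -/
theorem placeGate_cnot_eq_pauli (i j : Fin n) (h : i ≠ j) :
    placeGate (pairEmb i j h) cnot =
      (1 / 2 : ℂ) • ((1 : Matrix (QReg n) (QReg n) ℂ) + pauliOp (fun _ => false) (Pi.single i true) +
        pauliOp (Pi.single j true) (fun _ => false) - pauliOp (Pi.single j true) (Pi.single i true)) := by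
  refine ext_of_mulVec_basisState fun w => ?_
  rw [← cnotOn_toMatrix 0, cnotOn_mulVec_basisState, Matrix.smul_mulVec, Matrix.sub_mulVec, Matrix.add_mulVec,
    Matrix.add_mulVec, Matrix.one_mulVec, pauliOp_mulVec_basisState, pauliOp_mulVec_basisState,
    pauliOp_mulVec_basisState, sgn_single_left, sgn_zero_left, bxor_zero, bxor_single]
  rcases Bool.eq_false_or_eq_true (w i) with hi | hi
  · have e1 : Function.update w j (w j ^^ w i) = Function.update w j (!w j) := by rw [hi, Bool.xor_true]
    rw [e1]
    simp only [hi, if_true, neg_one_smul, one_smul, sub_neg_eq_add, add_neg_cancel, zero_add]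
    rw [← two_smul ℂ, smul_smul]
    norm_num
  · have e1 : Function.update w j (w j ^^ w i) = w := by rw [hi, Bool.xor_false, Function.update_eq_self]
    rw [e1]
    simp only [hi, Bool.false_eq_true, if_false, one_smul]
    rw [add_sub_assoc, sub_self, add_zero, ← two_smul ℂ, smul_smul]
    norm_num

/-! ### Conjugating Pauli operators through the Clifford generators -/

/-- **`H` conjugation**: `H_j (X^a Z^b) = (-1)^{a_j b_j} (X^{a'} Z^{b'}) H_j` with `a' = a[j ↦ b_j]`,
`b' = b[j ↦ a_j]` (`HXH = Z`, `HZH = X`, `HYH = -Y`; the Hadamard row update "swap `x_{ia}` with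
`z_{ia}`, `r_i := r_i ⊕ x_{ia} z_{ia}`" of the tableau algorithm). [cite: AaronsonGottesman2004, §III] -/
theorem hGate_mul_pauliOp (j : Fin n) (a b : QReg n) :
    placeGate (wireEmb j) hGate * pauliOp a b =
      ((if (a j && b j) then (-1 : ℂ) else 1) •
        pauliOp (Function.update a j (b j)) (Function.update b j (a j))) * placeGate (wireEmb j) hGate := by
  rw [placeGate_hGate_eq_pauli, Matrix.smul_mul, Matrix.mul_smul, Matrix.add_mul, Matrix.mul_add,
    Matrix.smul_mul, Matrix.smul_mul, pauliOp_mul,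
    pauliOp_mul, pauliOp_mul, pauliOp_mul, sgn_zero_left, sgn_single_left, sgn_single_right, sgn_zero_right,
    zero_bxor, bxor_zero, zero_bxor, bxor_zero, update_eq_ite a j, update_eq_ite b j]
  congr 1
  rcases Bool.eq_false_or_eq_true (a j) with ha | ha <;>
  rcases Bool.eq_false_or_eq_true (b j) with hb | hb <;>
  simp only [ha, hb, Bool.and_self, Bool.and_false, Bool.false_and, if_true, Bool.false_eq_true, if_false,
    Bool.true_eq_false, one_smul, neg_one_smul, smul_neg, neg_neg, bxor_apply, Pi.single_eq_same,
    Bool.xor_true, Bool.not_true, Bool.not_false, bxor_bxor_cancel, bxor_comm (Pi.single j true)] <;>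
  abel


/-- `(1 - i)/2 · i = (1 + i)/2`. [folklore] -/
theorem sCoeff_mul_I : (1 - Complex.I) / 2 * Complex.I = (1 + Complex.I) / 2 := by
  rw [div_mul_eq_mul_div, sub_mul, Complex.I_mul_I]; ring

/-- `(1 + i)/2 · i = -((1 - i)/2)`. [folklore] -/
theorem sCoeff_mul_I' : (1 + Complex.I) / 2 * Complex.I = -((1 - Complex.I) / 2) := by
  rw [div_mul_eq_mul_div, add_mul, Complex.I_mul_I]; ring

/-- **`S` conjugation**: `S_j (X^a Z^b) = i^{a_j} (X^a Z^{b ⊕ a_j e_j}) S_j` (`SXS† = Y`, `SZS† = Z`;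
the phase row update "`z_{ia} := z_{ia} ⊕ x_{ia}`" of the tableau algorithm, in the `X^a Z^b`
convention). [cite: AaronsonGottesman2004, §III] -/
theorem sGate_mul_pauliOp (j : Fin n) (a b : QReg n) :
    placeGate (wireEmb j) sGate * pauliOp a b =
      ((if a j then Complex.I else 1) • pauliOp a (if a j then bxor b (Pi.single j true) else b)) *
        placeGate (wireEmb j) sGate := by
  simp only [placeGate_sGate_eq_pauli, Matrix.add_mul, Matrix.mul_add, Matrix.smul_mul, Matrix.mul_smul,
    Matrix.one_mul, Matrix.mul_one, smul_smul, pauliOp_mul, sgn_single_left, sgn_zero_right, zero_bxor, bxor_zero,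
    bxor_comm (Pi.single j true) b]
  rcases Bool.eq_false_or_eq_true (a j) with ha | ha
  · simp only [ha, if_true, bxor_bxor_cancel, mul_neg, mul_one, neg_smul]
    rw [mul_comm ((1 + Complex.I) / 2) Complex.I, mul_comm ((1 - Complex.I) / 2) Complex.I,
      mul_comm Complex.I, mul_comm Complex.I, sCoeff_mul_I', sCoeff_mul_I, neg_smul]
    abel
  · simp only [ha, Bool.false_eq_true, if_false, mul_one]

/-- **`CNOT` conjugation** (control `i`, target `j`): `CNOT (X^a Z^b) = (X^{a ⊕ a_i e_j} Z^{b ⊕ b_j e_i}) CNOT`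
(`X_c ↦ X_c X_t`, `Z_t ↦ Z_c Z_t`; the `CNOT` row update "`x_{ib} := x_{ib} ⊕ x_{ia}`,
`z_{ia} := z_{ia} ⊕ z_{ib}`" of the tableau algorithm; no phase in the `X^a Z^b` convention).
[cite: AaronsonGottesman2004, §III] -/
theorem cnot_mul_pauliOp (i j : Fin n) (h : i ≠ j) (a b : QReg n) :
    placeGate (pairEmb i j h) cnot * pauliOp a b =
      pauliOp (if a i then bxor a (Pi.single j true) else a) (if b j then bxor b (Pi.single i true) else b) *
        placeGate (pairEmb i j h) cnot := by
  have hji : j ≠ i := h.symm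
  simp only [placeGate_cnot_eq_pauli, Matrix.smul_mul, Matrix.mul_smul, Matrix.sub_mul, Matrix.add_mul,
    Matrix.one_mul, Matrix.mul_sub, Matrix.mul_add, Matrix.mul_one, pauliOp_mul, sgn_single_left, sgn_zero_left,
    sgn_zero_right, sgn_single_right, zero_bxor, bxor_zero, one_smul]
  congr 1
  rcases Bool.eq_false_or_eq_true (a i) with ha | ha <;>
  rcases Bool.eq_false_or_eq_true (b j) with hb | hb <;>
  simp only [ha, hb, if_true, Bool.false_eq_true, if_false, one_smul, bxor_apply, Pi.single_eq_of_ne hji,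
    xor_zero_bool, bxor_bxor_cancel, bxor_comm (Pi.single j true), bxor_comm (Pi.single i true), neg_smul] <;>
  abel


/-! ### Pushing signed Pauli operators through Clifford circuits -/

/-- `W` **pushes** signed Paulis (right to left): `W (i^k X^a Z^b) = (i^{k'} X^{a'} Z^{b'}) W` for some
`k', a', b'`. [Gottesman 1998 (Heisenberg representation); Aaronson–Gottesman 2004, §III] [folklore] -/
def PushesPauli (W : Matrix (QReg n) (QReg n) ℂ) : Prop :=
  ∀ (k : ℕ) (a b : QReg n), ∃ (k' : ℕ) (a' b' : QReg n),
    W * (Complex.I ^ k • pauliOp a b) = (Complex.I ^ k' • pauliOp a' b') * W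

/-- `W` **pulls** signed Paulis (left to right): `(i^k X^a Z^b) W = W (i^{k'} X^{a'} Z^{b'})`.
[Aaronson–Gottesman 2004, §III] [folklore] -/
def PullsPauli (W : Matrix (QReg n) (QReg n) ℂ) : Prop :=
  ∀ (k : ℕ) (a b : QReg n), ∃ (k' : ℕ) (a' b' : QReg n),
    (Complex.I ^ k • pauliOp a b) * W = W * (Complex.I ^ k' • pauliOp a' b')

/-- The identity pushes Paulis. [folklore] -/
theorem pushesPauli_one : PushesPauli (1 : Matrix (QReg n) (QReg n) ℂ) :=
  fun k a b => ⟨k, a, b, by rw [Matrix.one_mul, Matrix.mul_one]⟩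

/-- The identity pulls Paulis. [folklore] -/
theorem pullsPauli_one : PullsPauli (1 : Matrix (QReg n) (QReg n) ℂ) :=
  fun k a b => ⟨k, a, b, by rw [Matrix.one_mul, Matrix.mul_one]⟩

/-- Pushing is closed under products. [folklore] -/
theorem PushesPauli.mul {W₁ W₂ : Matrix (QReg n) (QReg n) ℂ} (h₁ : PushesPauli W₁) (h₂ : PushesPauli W₂) :
    PushesPauli (W₁ * W₂) := by
  intro k a b
  obtain ⟨k₂, a₂, b₂, e₂⟩ := h₂ k a b
  obtain ⟨k₁, a₁, b₁, e₁⟩ := h₁ k₂ a₂ b₂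
  exact ⟨k₁, a₁, b₁, by rw [Matrix.mul_assoc, e₂, ← Matrix.mul_assoc, e₁, Matrix.mul_assoc]⟩

/-- Pulling is closed under products. [folklore] -/
theorem PullsPauli.mul {W₁ W₂ : Matrix (QReg n) (QReg n) ℂ} (h₁ : PullsPauli W₁) (h₂ : PullsPauli W₂) :
    PullsPauli (W₁ * W₂) := by
  intro k a b
  obtain ⟨k₁, a₁, b₁, e₁⟩ := h₁ k a b
  obtain ⟨k₂, a₂, b₂, e₂⟩ := h₂ k₁ a₁ b₁
  exact ⟨k₂, a₂, b₂, by rw [← Matrix.mul_assoc, e₁, Matrix.mul_assoc, e₂, Matrix.mul_assoc]⟩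

/-- A generator relation `g (X^a Z^b) = (i^m X^{a'} Z^{b'}) g` for all `a, b` gives pushing. [folklore] -/
theorem pushesPauli_of_rule {g : Matrix (QReg n) (QReg n) ℂ}
    (h : ∀ a b : QReg n, ∃ (m : ℕ) (a' b' : QReg n), g * pauliOp a b = (Complex.I ^ m • pauliOp a' b') * g) :
    PushesPauli g := by
  intro k a b
  obtain ⟨m, a', b', e⟩ := h a b
  refine ⟨k + m, a', b', ?_⟩
  rw [Matrix.mul_smul, e, Matrix.smul_mul, Matrix.smul_mul, smul_smul, pow_add]

/-- Pulling through `g` from pushing through a two-sided inverse `g'` of `g`. [folklore] -/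
theorem pullsPauli_of_inverse {g g' : Matrix (QReg n) (QReg n) ℂ} (hg' : PushesPauli g') (h₁ : g * g' = 1)
    (h₂ : g' * g = 1) : PullsPauli g := by
  intro k a b
  obtain ⟨k', a', b', e⟩ := hg' k a b
  refine ⟨k', a', b', ?_⟩
  calc (Complex.I ^ k • pauliOp a b) * g = (g * g') * (Complex.I ^ k • pauliOp a b) * g := by rw [h₁, Matrix.one_mul]
    _ = g * ((Complex.I ^ k' • pauliOp a' b') * g') * g := by rw [Matrix.mul_assoc g g', e]
    _ = g * (Complex.I ^ k' • pauliOp a' b') := by rw [Matrix.mul_assoc, Matrix.mul_assoc, h₂, Matrix.mul_one]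

/-- `(-1) = i²` and `1 = i⁰` as powers of `i`: the sign of the `H` rule. [folklore] -/
theorem ite_neg_one_eq_I_pow (c : Bool) :
    (if c then (-1 : ℂ) else 1) = Complex.I ^ (if c then 2 else 0) := by
  cases c <;> simp [Complex.I_sq]

/-- The phase of the `S` rule as a power of `i`. [folklore] -/
theorem ite_I_eq_I_pow (c : Bool) : (if c then Complex.I else 1) = Complex.I ^ (if c then 1 else 0) := by
  cases c <;> simp

/-- `H_j` pushes Paulis. [Aaronson–Gottesman 2004, §III] [folklore] -/
theorem pushesPauli_hGate (j : Fin n) : PushesPauli (placeGate (wireEmb j) hGate) :=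
  pushesPauli_of_rule fun a b => ⟨_, _, _, by rw [hGate_mul_pauliOp, ite_neg_one_eq_I_pow]⟩

/-- `S_j` pushes Paulis. [Aaronson–Gottesman 2004, §III] [folklore] -/
theorem pushesPauli_sGate (j : Fin n) : PushesPauli (placeGate (wireEmb j) sGate) :=
  pushesPauli_of_rule fun a b => ⟨_, _, _, by rw [sGate_mul_pauliOp, ite_I_eq_I_pow]⟩

/-- `CNOT` pushes Paulis. [Aaronson–Gottesman 2004, §III] [folklore] -/
theorem pushesPauli_cnot (i j : Fin n) (h : i ≠ j) : PushesPauli (placeGate (pairEmb i j h) cnot) :=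
  pushesPauli_of_rule fun a b => ⟨0, _, _, by rw [cnot_mul_pauliOp, pow_zero, one_smul]⟩

/-- `H_j² = 1`. [Nielsen–Chuang 2010, §1.3.1] [folklore] -/
theorem placeGate_hGate_mul_self (j : Fin n) :
    placeGate (wireEmb j) hGate * placeGate (wireEmb j) hGate = 1 := by
  rw [← hOn_toMatrix 0, hOn_mul_hOn]

/-- `S_j⁴ = 1` (as `S_j · S_j³ = 1`). [Nielsen–Chuang 2010, §4.2] [folklore] -/
theorem placeGate_sGate_pow_four (j : Fin n) :
    placeGate (wireEmb j) sGate * (placeGate (wireEmb j) sGate * placeGate (wireEmb j) sGate *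
      placeGate (wireEmb j) sGate) = 1 := by
  refine ext_of_mulVec_basisState fun w => ?_
  simp only [← Matrix.mulVec_mulVec, ← sOn_toMatrix 0, sOn_mulVec_basisState, Matrix.mulVec_smul, Matrix.one_mulVec,
    smul_smul]
  rcases Bool.eq_false_or_eq_true (w j) with hj | hj
  · simp only [hj, if_true]
    ring_nf
    rw [Complex.I_pow_four, one_smul]
  · simp [hj]

/-- `CNOT² = 1`. [Nielsen–Chuang 2010, §1.3.2] [folklore] -/
theorem placeGate_cnot_mul_self (i j : Fin n) (h : i ≠ j) :
    placeGate (pairEmb i j h) cnot * placeGate (pairEmb i j h) cnot = 1 := by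
  refine ext_of_mulVec_basisState fun w => ?_
  rw [← Matrix.mulVec_mulVec, ← cnotOn_toMatrix 0, cnotOn_mulVec_basisState, cnotOn_mulVec_basisState,
    Matrix.one_mulVec]
  congr 1
  funext l
  by_cases hl : l = j
  · subst hl
    simp [Function.update_of_ne h]
  · simp [hl]

/-- Retyping the placement of a Clifford `H` gate as `Fin 1 ↪ Fin n` (definitional). [folklore] -/
abbrev cembH (e : Fin (clifford.arity CliffordOp.H) ↪ Fin n) : Fin 1 ↪ Fin n := e

/-- Retyping the placement of a Clifford `S` gate as `Fin 1 ↪ Fin n` (definitional). [folklore] -/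
abbrev cembS (e : Fin (clifford.arity CliffordOp.S) ↪ Fin n) : Fin 1 ↪ Fin n := e

/-- Retyping the placement of a Clifford `CNOT` gate as `Fin 2 ↪ Fin n` (definitional). [folklore] -/
abbrev cembC (e : Fin (clifford.arity CliffordOp.CNOT) ↪ Fin n) : Fin 2 ↪ Fin n := e

/-- The three kinds of Clifford generator placements. [folklore] -/
theorem mem_placements_clifford_cases {M : Matrix (QReg n) (QReg n) ℂ} (hM : M ∈ placements clifford n) :
    (∃ j, M = placeGate (wireEmb j) hGate) ∨ (∃ j, M = placeGate (wireEmb j) sGate) ∨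
      (∃ (i j : Fin n) (h : i ≠ j), M = placeGate (pairEmb i j h) cnot) := by
  obtain ⟨g, e, rfl⟩ := hM
  cases g with
  | H =>
    exact Or.inl ⟨cembH e 0, congrArg (fun f : Fin 1 ↪ Fin n => placeGate f hGate) (emb_one_eq_wireEmb (cembH e))⟩
  | S =>
    exact Or.inr (Or.inl ⟨cembS e 0,
      congrArg (fun f : Fin 1 ↪ Fin n => placeGate f sGate) (emb_one_eq_wireEmb (cembS e))⟩)
  | CNOT =>
    exact Or.inr (Or.inr ⟨cembC e 0, cembC e 1, emb_two_ne (cembC e),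
      congrArg (fun f : Fin 2 ↪ Fin n => placeGate f cnot) (emb_two_eq_pairEmb (cembC e))⟩)

/-- `H_j` is a Clifford circuit. [folklore] -/
theorem placeGate_hGate_mem (j : Fin n) : placeGate (wireEmb j) hGate ∈ cliffordCircuits n :=
  Submonoid.subset_closure ⟨CliffordOp.H, wireEmb j, rfl⟩

/-- `S_j` is a Clifford circuit. [folklore] -/
theorem placeGate_sGate_mem (j : Fin n) : placeGate (wireEmb j) sGate ∈ cliffordCircuits n :=
  Submonoid.subset_closure ⟨CliffordOp.S, wireEmb j, rfl⟩

/-- `CNOT_{ij}` is a Clifford circuit. [folklore] -/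
theorem placeGate_cnot_mem (i j : Fin n) (h : i ≠ j) : placeGate (pairEmb i j h) cnot ∈ cliffordCircuits n :=
  Submonoid.subset_closure ⟨CliffordOp.CNOT, pairEmb i j h, rfl⟩

/-- **Clifford circuits are invertible inside the Clifford monoid** (`H⁻¹ = H`, `S⁻¹ = S³`,
`CNOT⁻¹ = CNOT`). [Aaronson–Gottesman 2004, §I] [folklore] -/
theorem exists_inverse_of_mem_cliffordCircuits {W : Matrix (QReg n) (QReg n) ℂ} (hW : W ∈ cliffordCircuits n) :
    ∃ W' ∈ cliffordCircuits n, W' * W = 1 ∧ W * W' = 1 := by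
  unfold cliffordCircuits at hW
  induction hW using Submonoid.closure_induction with
  | mem M hM =>
    rcases mem_placements_clifford_cases hM with ⟨j, rfl⟩ | ⟨j, rfl⟩ | ⟨i, j, h, rfl⟩
    · exact ⟨_, placeGate_hGate_mem j, placeGate_hGate_mul_self j, placeGate_hGate_mul_self j⟩
    · refine ⟨placeGate (wireEmb j) sGate * placeGate (wireEmb j) sGate * placeGate (wireEmb j) sGate,
        Submonoid.mul_mem _ (Submonoid.mul_mem _ (placeGate_sGate_mem j) (placeGate_sGate_mem j))
          (placeGate_sGate_mem j), ?_, placeGate_sGate_pow_four j⟩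
      simpa only [Matrix.mul_assoc] using placeGate_sGate_pow_four j
    · exact ⟨_, placeGate_cnot_mem i j h, placeGate_cnot_mul_self i j h, placeGate_cnot_mul_self i j h⟩
  | one => exact ⟨1, Submonoid.one_mem _, Matrix.one_mul _, Matrix.one_mul _⟩
  | mul M M' _ _ ih ih' =>
    obtain ⟨W₁, h₁, l₁, r₁⟩ := ih
    obtain ⟨W₂, h₂, l₂, r₂⟩ := ih'
    refine ⟨W₂ * W₁, Submonoid.mul_mem _ h₂ h₁, ?_, ?_⟩
    · rw [Matrix.mul_assoc, ← Matrix.mul_assoc W₁, l₁, Matrix.one_mul, l₂]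
    · rw [Matrix.mul_assoc, ← Matrix.mul_assoc M', r₂, Matrix.one_mul, r₁]

/-- **Gottesman–Knill, Heisenberg form**: every Clifford circuit pushes and pulls signed Pauli
operators (closure induction over the generators; Aaronson–Gottesman 2004, §III: the tableau of
`CNOT`, `H`, `S` updates). [cite: AaronsonGottesman2004, §III] -/
theorem pushesPauli_and_pullsPauli_of_mem {W : Matrix (QReg n) (QReg n) ℂ} (hW : W ∈ cliffordCircuits n) :
    PushesPauli W ∧ PullsPauli W := by
  unfold cliffordCircuits at hW
  induction hW using Submonoid.closure_induction with
  | mem M hM =>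
    rcases mem_placements_clifford_cases hM with ⟨j, rfl⟩ | ⟨j, rfl⟩ | ⟨i, j, h, rfl⟩
    · exact ⟨pushesPauli_hGate j,
        pullsPauli_of_inverse (pushesPauli_hGate j) (placeGate_hGate_mul_self j) (placeGate_hGate_mul_self j)⟩
    · refine ⟨pushesPauli_sGate j, pullsPauli_of_inverse
        (((pushesPauli_sGate j).mul (pushesPauli_sGate j)).mul (pushesPauli_sGate j))
        (placeGate_sGate_pow_four j) ?_⟩
      simpa only [Matrix.mul_assoc] using placeGate_sGate_pow_four j
    · exact ⟨pushesPauli_cnot i j h,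
        pullsPauli_of_inverse (pushesPauli_cnot i j h) (placeGate_cnot_mul_self i j h)
          (placeGate_cnot_mul_self i j h)⟩
  | one => exact ⟨pushesPauli_one, pullsPauli_one⟩
  | mul M M' _ _ ih ih' => exact ⟨ih.1.mul ih'.1, ih.2.mul ih'.2⟩

/-! ### GHZ-type states are stabilizer states -/

/-- `invSqrt2 ≠ 0`. [folklore] -/
theorem invSqrt2_ne_zero : invSqrt2 ≠ 0 := fun h => by
  have := invSqrt2_mul_invSqrt2
  rw [h, zero_mul] at this
  norm_num at this

/-- `|0…0⟩[j ↦ 1] = |e_j⟩`. [folklore] -/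
theorem update_zero_true_eq_single (j : Fin n) :
    Function.update (fun _ : Fin n => false) j true = Pi.single j true := by
  funext i
  by_cases h : i = j
  · subst h; simp
  · rw [Function.update_of_ne h, Pi.single_eq_of_ne h]; rfl

/-- Powers of `S_j` on basis states: `S_j^k |w⟩ = i^{k w_j} |w⟩`. [Nielsen–Chuang 2010, §4.2] [folklore] -/
theorem sGate_pow_mulVec_basisState (j : Fin n) (k : ℕ) (w : QReg n) :
    placeGate (wireEmb j) sGate ^ k *ᵥ basisState w = (if w j then Complex.I else 1) ^ k • basisState w := by
  induction k with
  | zero => simp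
  | succ k ih =>
    rw [pow_succ, ← Matrix.mulVec_mulVec, ← sOn_toMatrix 0, sOn_mulVec_basisState, Matrix.mulVec_smul,
      sOn_toMatrix, ih, smul_smul, ← pow_succ']

/-- The `CNOT` from `j` to `l` if `l ≠ j`, else the identity. [folklore] -/
def cxGate (j l : Fin n) : Matrix (QReg n) (QReg n) ℂ :=
  if h : j = l then 1 else placeGate (pairEmb j l h) cnot

/-- `cxGate j l` is a Clifford circuit. [folklore] -/
theorem cxGate_mem (j l : Fin n) : cxGate j l ∈ cliffordCircuits n := by
  unfold cxGate
  split_ifs with h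
  · exact Submonoid.one_mem _
  · exact placeGate_cnot_mem j l h

/-- `cxGate j l` on a basis state: flip `l` iff `w j` (nothing if `l = j`). [Nielsen–Chuang 2010, §1.3.2] [folklore] -/
theorem cxGate_mulVec_basisState (j l : Fin n) (w : QReg n) :
    cxGate j l *ᵥ basisState w = basisState (if l ≠ j ∧ w j then Function.update w l (!w l) else w) := by
  unfold cxGate
  by_cases h : j = l
  · rw [dif_pos h, Matrix.one_mulVec, if_neg (fun h' => h'.1 h.symm)]
  · rw [dif_neg h, ← cnotOn_toMatrix 0, cnotOn_mulVec_basisState]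
    rcases Bool.eq_false_or_eq_true (w j) with hw | hw
    · rw [if_pos ⟨Ne.symm h, hw⟩, hw, Bool.xor_true]
    · rw [if_neg (fun h' => by rw [hw] at h'; exact Bool.false_ne_true h'.2), hw, Bool.xor_false,
        Function.update_eq_self]

/-- The fan-out `∏_{l ∈ L} CNOT_{j → l}`. [folklore] -/
def fanOut (j : Fin n) (L : List (Fin n)) : Matrix (QReg n) (QReg n) ℂ :=
  (L.map (cxGate j)).prod

/-- The fan-out is a Clifford circuit. [folklore] -/
theorem fanOut_mem (j : Fin n) (L : List (Fin n)) : fanOut j L ∈ cliffordCircuits n := by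
  unfold fanOut
  apply Submonoid.list_prod_mem
  intro M hM
  rw [List.mem_map] at hM
  obtain ⟨l, _, rfl⟩ := hM
  exact cxGate_mem j l

/-- The fan-out fixes basis states with control bit `0`. [folklore] -/
theorem fanOut_mulVec_basisState_of_false (j : Fin n) {w : QReg n} (hw : w j = false) :
    ∀ L : List (Fin n), fanOut j L *ᵥ basisState w = basisState w
  | [] => by simp [fanOut]
  | l :: L => by
    rw [fanOut, List.map_cons, List.prod_cons, ← Matrix.mulVec_mulVec, ← fanOut,
      fanOut_mulVec_basisState_of_false j hw L, cxGate_mulVec_basisState, if_neg]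
    rw [hw]; simp

/-- The fan-out on a basis state with control bit `1` flips every listed wire (list without
repetition, not containing the control). [Nielsen–Chuang 2010, §1.3.2] [folklore] -/
theorem fanOut_mulVec_basisState_of_true (j : Fin n) {w : QReg n} (hw : w j = true) :
    ∀ L : List (Fin n), L.Nodup → j ∉ L →
      fanOut j L *ᵥ basisState w = basisState (fun i => if i ∈ L then !w i else w i)
  | [], _, _ => by simp [fanOut]
  | l :: L, hnd, hj => by
    rw [List.nodup_cons] at hnd
    rw [List.mem_cons, not_or] at hj
    rw [fanOut, List.map_cons, List.prod_cons, ← Matrix.mulVec_mulVec, ← fanOut,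
      fanOut_mulVec_basisState_of_true j hw L hnd.2 hj.2, cxGate_mulVec_basisState, if_pos]
    · congr 1
      funext i
      by_cases hil : i = l
      · subst hil
        simp [hnd.1]
      · rw [Function.update_of_ne hil]
        simp [hil]
    · refine ⟨Ne.symm hj.1, ?_⟩
      simp [hj.2, hw]

/-- **GHZ-type states are stabilizer states**: for `a ≠ 0` and any `k`,
`(|0ⁿ⟩ + i^k |a⟩)/√2 = V|0ⁿ⟩` for the Clifford circuit `V = (∏_{l : a_l = 1, l ≠ j} CNOT_{j→l}) S_j^k H_j`
(`a_j = 1`). [Nielsen–Chuang 2010, §1.3.6 (Bell/GHZ preparation); Aaronson–Gottesman 2004, §I] [folklore] -/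
theorem exists_clifford_ghz {a : QReg n} {j : Fin n} (hj : a j = true) (k : ℕ) :
    ∃ V ∈ cliffordCircuits n,
      V *ᵥ zeroState n = invSqrt2 • (zeroState n + Complex.I ^ k • basisState a) := by
  classical
  set L := (Finset.univ.filter fun l : Fin n => a l = true ∧ l ≠ j).toList with hL
  have hLn : L.Nodup := Finset.nodup_toList _
  have hjL : j ∉ L := by simp [hL]
  have hmem : ∀ i, i ∈ L ↔ a i = true ∧ i ≠ j := fun i => by simp [hL]
  refine ⟨fanOut j L * (placeGate (wireEmb j) sGate ^ k * placeGate (wireEmb j) hGate),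
    Submonoid.mul_mem _ (fanOut_mem j L)
      (Submonoid.mul_mem _ (Submonoid.pow_mem _ (placeGate_sGate_mem j) k) (placeGate_hGate_mem j)), ?_⟩
  rw [← Matrix.mulVec_mulVec, ← Matrix.mulVec_mulVec, zeroState, ← hOn_toMatrix 0,
    hOn_mulVec_basisState j _ rfl, Matrix.mulVec_smul, Matrix.mulVec_smul, Matrix.mulVec_add, Matrix.mulVec_add,
    sGate_pow_mulVec_basisState, sGate_pow_mulVec_basisState, update_zero_true_eq_single]
  simp only [Bool.false_eq_true, if_false, one_pow, one_smul, Pi.single_eq_same, if_true, Matrix.mulVec_smul]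
  have hsj : (Pi.single j true : QReg n) j = true := by simp
  have hlab : (fun i => if i ∈ L then !(Pi.single j true : QReg n) i else (Pi.single j true : QReg n) i) = a := by
    funext i
    by_cases hij : i = j
    · subst hij
      rw [if_neg hjL, hsj, hj]
    · rw [Pi.single_eq_of_ne hij]
      rcases Bool.eq_false_or_eq_true (a i) with hai | hai
      · rw [if_pos ((hmem i).2 ⟨hai, hij⟩), hai]; rfl
      · rw [if_neg (fun h' => by rw [((hmem i).1 h').1] at hai; exact Bool.noConfusion hai), hai]; rfl
  rw [fanOut_mulVec_basisState_of_false j rfl, fanOut_mulVec_basisState_of_true j hsj L hLn hjL, hlab]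

/-! ### Pauli projections of stabilizer states -/

/-- A signed Pauli on the vacuum: `(i^k X^a Z^b)|0ⁿ⟩ = i^k |a⟩`. [folklore] -/
theorem signedPauli_mulVec_zeroState (k : ℕ) (a b : QReg n) :
    (Complex.I ^ k • pauliOp a b) *ᵥ zeroState n = Complex.I ^ k • basisState a := by
  rw [Matrix.smul_mulVec, zeroState, pauliOp_mulVec_basisState, sgn_zero_right, one_smul, zero_bxor]

/-- **Pauli projections preserve stabilizer states up to scale** (the Gottesman–Knill
measurement rule, operational form): for a stabilizer state `Ψ` and a signed Pauli `h = i^k X^a Z^b`,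
`Ψ + hΨ = c Ψ'` for a stabilizer state `Ψ'` and a scalar `c` (possibly `0`) — the content of the
"Measurement of qubit `a` in standard basis" update of the tableau algorithm (Case I random /
Case II determinate), here for an arbitrary signed Pauli and proved by pushing `h` through the
preparing circuit and the GHZ lemma. [cite: AaronsonGottesman2004, §III] -/
theorem exists_smul_stabilizer_of_pauliProj {Ψ : QReg n → ℂ} (hΨ : Ψ ∈ stabilizerStates n) (k : ℕ)
    (a b : QReg n) :
    ∃ (c : ℂ) (Ψ' : QReg n → ℂ), Ψ' ∈ stabilizerStates n ∧
      Ψ + (Complex.I ^ k • pauliOp a b) *ᵥ Ψ = c • Ψ' := by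
  obtain ⟨W, hW, rfl⟩ := hΨ
  obtain ⟨k', a', b', e⟩ := (pushesPauli_and_pullsPauli_of_mem hW).2 k a b
  have key : W *ᵥ zeroState n + (Complex.I ^ k • pauliOp a b) *ᵥ (W *ᵥ zeroState n) =
      W *ᵥ (zeroState n + Complex.I ^ k' • basisState a') := by
    rw [Matrix.mulVec_mulVec, e, ← Matrix.mulVec_mulVec, signedPauli_mulVec_zeroState, Matrix.mulVec_add]
  rw [key]
  by_cases ha : ∃ j, a' j = true
  · obtain ⟨j, hj⟩ := ha
    obtain ⟨V, hV, hV0⟩ := exists_clifford_ghz hj k'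
    refine ⟨invSqrt2⁻¹, (W * V) *ᵥ zeroState n, ⟨W * V, Submonoid.mul_mem _ hW hV, rfl⟩, ?_⟩
    rw [← Matrix.mulVec_mulVec, hV0, Matrix.mulVec_smul, smul_smul, inv_mul_cancel₀ invSqrt2_ne_zero, one_smul]
  · have ha' : a' = fun _ => false := funext fun j => by
      rcases Bool.eq_false_or_eq_true (a' j) with h | h
      · exact absurd ⟨j, h⟩ ha
      · exact h
    refine ⟨1 + Complex.I ^ k', W *ᵥ zeroState n, ⟨W, hW, rfl⟩, ?_⟩
    rw [ha', ← zeroState, ← Matrix.mulVec_smul]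
    congr 1
    rw [add_smul, one_smul]

/-! ### Registers split as `m + t` wires: appended labels -/

section append

variable {m t : ℕ}

/-- Every label on `m + t` wires is an appended pair. [folklore] -/
theorem exists_eq_append (z : QReg (m + t)) : ∃ (x : QReg m) (y : QReg t), z = Fin.append x y :=
  ⟨fun i => z (Fin.castAdd t i), fun j => z (Fin.natAdd m j), Fin.append_castAdd_natAdd.symm⟩

/-- `⊕` of appended labels is computed blockwise. [folklore] -/
theorem bxor_append (x x' : QReg m) (y y' : QReg t) :
    bxor (Fin.append x y) (Fin.append x' y') = Fin.append (bxor x x') (bxor y y') := by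
  funext i
  refine Fin.addCases (fun l => ?_) (fun r => ?_) i
  · simp only [bxor_apply, Fin.append_left]
  · simp only [bxor_apply, Fin.append_right]

/-- The sign of appended labels is the product of the block signs. [folklore] -/
theorem sgn_append (b w : QReg m) (β ω : QReg t) :
    sgn (Fin.append b β) (Fin.append w ω) = sgn b w * sgn β ω := by
  unfold sgn
  rw [Fin.prod_univ_add]
  simp only [Fin.append_left, Fin.append_right]

/-- The tree's tensor product on appended labels: `(ψ ⊗ φ)(x, y) = ψ(x) φ(y)`. [folklore] -/
theorem tensorVec_append (ψ : QReg m → ℂ) (φ : QReg t → ℂ) (x : QReg m) (y : QReg t) :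
    tensorVec ψ φ (Fin.append x y) = ψ x * φ y := by
  simp only [tensorVec_apply, Fin.append_left, Fin.append_right]

/-- Sums over `m + t` wires as double sums. [folklore] -/
theorem sum_qReg_add (f : QReg (m + t) → ℂ) : ∑ z, f z = ∑ x : QReg m, ∑ y : QReg t, f (Fin.append x y) := by
  rw [← Fintype.sum_prod_type']
  exact (Fintype.sum_equiv (Fin.appendEquiv m t) _ _ fun p => rfl).symm

/-- **Restriction to the block `|0^t⟩` of the last `t` wires**: `(1 ⊗ ⟨0^t|) Φ`, i.e.
`x ↦ Φ(x, 0^t)`. [Bravyi et al. 2019, §2.3.1 (the map `1 ⊗ ⟨0^t|`)] [folklore] -/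
def projZ (t : ℕ) {m : ℕ} (Φ : QReg (m + t) → ℂ) : QReg m → ℂ := fun x => Φ (Fin.append x fun _ => false)

/-- Evaluation of the restriction (definitional). [folklore] -/
theorem projZ_apply (t : ℕ) (Φ : QReg (m + t) → ℂ) (x : QReg m) :
    projZ t Φ x = Φ (Fin.append x fun _ => false) := rfl

/-- The restriction is additive. [folklore] -/
theorem projZ_add (t : ℕ) (Φ Ψ : QReg (m + t) → ℂ) : projZ t (Φ + Ψ) = projZ t Φ + projZ t Ψ := rfl

/-- The restriction commutes with scalars. [folklore] -/
theorem projZ_smul (t : ℕ) (c : ℂ) (Φ : QReg (m + t) → ℂ) : projZ t (c • Φ) = c • projZ t Φ := rfl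

/-- The restriction commutes with finite sums. [folklore] -/
theorem projZ_sum (t : ℕ) {ι : Type*} (s : Finset ι) (Φ : ι → QReg (m + t) → ℂ) :
    projZ t (∑ i ∈ s, Φ i) = ∑ i ∈ s, projZ t (Φ i) := by
  funext x
  simp [projZ_apply, Finset.sum_apply]

/-- `(1 ⊗ ⟨0^t|)(ψ ⊗ φ) = φ(0^t) ψ`. [folklore] -/
theorem projZ_tensorVec (ψ : QReg m → ℂ) (φ : QReg t → ℂ) :
    projZ t (tensorVec ψ φ) = φ (fun _ => false) • ψ := by
  funext x
  rw [projZ_apply, tensorVec_append, Pi.smul_apply, smul_eq_mul, mul_comm]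

/-- In particular `(1 ⊗ ⟨0^t|)(ψ ⊗ |0^t⟩) = ψ`. [folklore] -/
theorem projZ_tensorVec_zeroState (ψ : QReg m → ℂ) : projZ t (tensorVec ψ (zeroState t)) = ψ := by
  rw [projZ_tensorVec, zeroState, basisState_apply, if_pos rfl, one_smul]

/-- An operator on the first `m` wires commutes with `1 ⊗ ⟨0^t|`:
`(1 ⊗ ⟨0^t|)(C ⊗ 1)Φ = C (1 ⊗ ⟨0^t|)Φ`. [Nielsen–Chuang 2010, §2.1.7] [folklore] -/
theorem projZ_placeGate_castAddEmb_mulVec (C : Matrix (QReg m) (QReg m) ℂ) (Φ : QReg (m + t) → ℂ) :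
    projZ t (placeGate (Fin.castAddEmb t) C *ᵥ Φ) = C *ᵥ projZ t Φ := by
  funext x
  have hc : ∀ u : QReg m, ((Fin.append u fun _ : Fin t => false) ∘ ⇑(Fin.castAddEmb t)) = u :=
    fun u => funext fun i => Fin.append_left u _ i
  rw [projZ_apply, Matrix.mulVec, Matrix.mulVec, dotProduct, dotProduct, sum_qReg_add]
  refine Finset.sum_congr rfl fun x' _ => ?_
  rw [Finset.sum_eq_single (fun _ => false)]
  · rw [placeGate_apply, if_pos, projZ_apply, hc, hc]
    intro i hi
    induction i using Fin.addCases with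
    | left l => exact absurd ⟨l, rfl⟩ hi
    | right j => rw [Fin.append_right, Fin.append_right]
  · intro y _ hy
    rw [placeGate_apply, if_neg, zero_mul]
    intro h
    apply hy
    funext j
    have := h (Fin.natAdd m j) (natAdd_not_mem_range_castAddEmb j)
    rwa [Fin.append_right, Fin.append_right, eq_comm] at this
  · intro h; exact absurd (Finset.mem_univ _) h

end append

/-! ### Removing a postselected qubit: `(1 ⊗ ⟨0|) Stab_{n+1} ⊆ ℂ · Stab_n` -/

section removal

/-- A vector fixed by every `Z_i` is a multiple of the vacuum. [folklore] -/
theorem eq_smul_zeroState_of_forall_pauliZ {Ω : QReg n → ℂ}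
    (h : ∀ i : Fin n, pauliOp (fun _ => false) (Pi.single i true) *ᵥ Ω = Ω) :
    Ω = Ω (fun _ => false) • zeroState n := by
  funext z
  rw [Pi.smul_apply, zeroState, basisState_apply, smul_eq_mul]
  by_cases hz : z = fun _ => false
  · rw [if_pos hz, hz, mul_one]
  · rw [if_neg hz, mul_zero]
    obtain ⟨i, hi⟩ : ∃ i, z i = true := by
      by_contra hc
      push Not at hc
      exact hz (funext fun i => Bool.eq_false_iff.2 (hc i))
    have := congrFun (h i) z
    rw [pauliOp_mulVec_apply, bxor_zero, sgn_single_left, hi, if_pos rfl] at this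
    linear_combination (-(1 : ℂ) / 2) * this

/-- The product `∏ (1 + h_l)` over a list of operators. [folklore] -/
def projProd (L : List (Matrix (QReg n) (QReg n) ℂ)) : Matrix (QReg n) (QReg n) ℂ := (L.map (1 + ·)).prod

/-- The empty product is `1`. [folklore] -/
theorem projProd_nil : projProd ([] : List (Matrix (QReg n) (QReg n) ℂ)) = 1 := by simp [projProd]

/-- One more factor: `(∏_{l :: L} (1 + h)) v = (∏_L) v + h_l ((∏_L) v)`. [folklore] -/
theorem projProd_cons_mulVec (h : Matrix (QReg n) (QReg n) ℂ) (L : List (Matrix (QReg n) (QReg n) ℂ))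
    (v : QReg n → ℂ) : projProd (h :: L) *ᵥ v = projProd L *ᵥ v + h *ᵥ (projProd L *ᵥ v) := by
  rw [projProd, List.map_cons, List.prod_cons, ← projProd, ← Matrix.mulVec_mulVec, Matrix.add_mulVec,
    Matrix.one_mulVec]

/-- If commuting involutions (at the level of their actions) are listed, every listed one fixes
the range of `∏ (1 + h_l)`. [folklore] -/
theorem mulVec_projProd_of_mem {ι : Type*} (hs : ι → Matrix (QReg n) (QReg n) ℂ)
    (comm : ∀ i j (v : QReg n → ℂ), hs i *ᵥ (hs j *ᵥ v) = hs j *ᵥ (hs i *ᵥ v))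
    (invol : ∀ i (v : QReg n → ℂ), hs i *ᵥ (hs i *ᵥ v) = v) :
    ∀ (L : List ι) (v : QReg n → ℂ), ∀ i ∈ L, hs i *ᵥ (projProd (L.map hs) *ᵥ v) = projProd (L.map hs) *ᵥ v
  | [], _, i, hi => absurd hi List.not_mem_nil
  | l :: L, v, i, hi => by
    rw [List.map_cons, projProd_cons_mulVec, Matrix.mulVec_add]
    rcases List.mem_cons.1 hi with rfl | hi'
    · rw [invol, add_comm]
    · rw [mulVec_projProd_of_mem hs comm invol L v i hi', comm, mulVec_projProd_of_mem hs comm invol L v i hi']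

/-- On a common fixed vector, `∏ (1 + h_l)` acts as `2^{|L|}`. [folklore] -/
theorem projProd_mulVec_of_fixed {ι : Type*} (hs : ι → Matrix (QReg n) (QReg n) ℂ) (v : QReg n → ℂ) :
    ∀ L : List ι, (∀ i ∈ L, hs i *ᵥ v = v) → projProd (L.map hs) *ᵥ v = (2 : ℂ) ^ L.length • v
  | [], _ => by rw [List.map_nil, projProd_nil, Matrix.one_mulVec, List.length_nil, pow_zero, one_smul]
  | l :: L, h => by
    have h' : ∀ i ∈ L, hs i *ᵥ v = v := fun i hi => h i (List.mem_cons_of_mem _ hi)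
    rw [List.map_cons, projProd_cons_mulVec, projProd_mulVec_of_fixed hs v L h', Matrix.mulVec_smul,
      h l List.mem_cons_self, List.length_cons, pow_succ, mul_comm, ← smul_smul, two_smul]

/-- `∏ (1 + h_l)` applied to a stabilizer state is a scaled stabilizer state when the `h_l` are
signed Paulis. [Aaronson–Gottesman 2004, §III] [folklore] -/
theorem exists_smul_stabilizer_projProd (k : Fin (n + 1) → ℕ) (a b : Fin (n + 1) → QReg n) {Ψ : QReg n → ℂ}
    (hΨ : Ψ ∈ stabilizerStates n) :
    ∀ L : List (Fin (n + 1)), ∃ (c : ℂ) (Ψ' : QReg n → ℂ), Ψ' ∈ stabilizerStates n ∧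
      projProd (L.map fun i => Complex.I ^ k i • pauliOp (a i) (b i)) *ᵥ Ψ = c • Ψ'
  | [] => ⟨1, Ψ, hΨ, by rw [List.map_nil, projProd_nil, Matrix.one_mulVec, one_smul]⟩
  | l :: L => by
    obtain ⟨c, Ψ', hΨ', e⟩ := exists_smul_stabilizer_projProd k a b hΨ L
    obtain ⟨c', Ψ'', hΨ'', e'⟩ := exists_smul_stabilizer_of_pauliProj hΨ' (k l) (a l) (b l)
    refine ⟨c * c', Ψ'', hΨ'', ?_⟩
    rw [List.map_cons, projProd_cons_mulVec, e, Matrix.mulVec_smul, ← smul_add, e', smul_smul]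

end removal

section removal2

variable {m t : ℕ}

/-- A Clifford circuit applied to the vacuum is nonzero. [folklore] -/
theorem mulVec_zeroState_ne_zero {W : Matrix (QReg m) (QReg m) ℂ} (hW : W ∈ cliffordCircuits m) :
    W *ᵥ zeroState m ≠ 0 := by
  obtain ⟨W', _, hl, _⟩ := exists_inverse_of_mem_cliffordCircuits hW
  intro h
  have := congrFun (congrArg (fun v => W' *ᵥ v) h) (fun _ => false)
  simp only [Matrix.mulVec_mulVec, hl, Matrix.one_mulVec, Matrix.mulVec_zero, Pi.zero_apply, zeroState,
    basisState_apply] at this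
  exact one_ne_zero this

/-- A vector on `m + 1` wires vanishing on both values of the last wire is zero. [folklore] -/
theorem eq_zero_of_append_vanishing {Φ : QReg (m + 1) → ℂ} (h0 : ∀ x, Φ (Fin.append x fun _ => false) = 0)
    (h1 : ∀ x, Φ (Fin.append x fun _ => true) = 0) : Φ = 0 := by
  funext z
  obtain ⟨x, y, rfl⟩ := exists_eq_append z
  have hy : y = fun _ => y 0 := funext fun j => by rw [Subsingleton.elim j 0]
  rw [hy]
  cases y 0
  · exact h0 x
  · exact h1 x

/-- A signed Pauli with blockwise labels, evaluated at an appended label. [folklore] -/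
theorem signedPauli_mulVec_apply_append (k : ℕ) (aI bI : QReg m) (aL bL : QReg t) (Φ : QReg (m + t) → ℂ)
    (x : QReg m) (y : QReg t) :
    ((Complex.I ^ k • pauliOp (Fin.append aI aL) (Fin.append bI bL)) *ᵥ Φ) (Fin.append x y) =
      Complex.I ^ k * (sgn bI (bxor x aI) * sgn bL (bxor y aL)) * Φ (Fin.append (bxor x aI) (bxor y aL)) := by
  rw [Matrix.smul_mulVec, Pi.smul_apply, smul_eq_mul, pauliOp_mulVec_apply, bxor_append, sgn_append]
  ring

/-- A vector on `m + 1` wires vanishing when the last wire is `1` is `(its restriction) ⊗ |0⟩`. [folklore] -/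
theorem eq_tensorVec_projZ_of_vanishing {Φ : QReg (m + 1) → ℂ} (h1 : ∀ x, Φ (Fin.append x fun _ => true) = 0) :
    Φ = tensorVec (projZ 1 Φ) (zeroState 1) := by
  funext z
  obtain ⟨x, y, rfl⟩ := exists_eq_append z
  have hy : y = fun _ => y 0 := funext fun j => by rw [Subsingleton.elim j 0]
  rw [tensorVec_append, projZ_apply, hy, zeroState, basisState_apply]
  cases y 0
  · rw [if_pos rfl, mul_one]
  · rw [h1, if_neg, mul_zero]
    intro h
    exact Bool.noConfusion (congrFun h 0)

/-- **Removing a postselected qubit (core case).** If `Φ` is a stabilizer state on `m + 1` qubits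
whose last qubit is in `|0⟩` (i.e. `Φ(x,1) = 0` for all `x`), then `x ↦ Φ(x,0)` is a scaled stabilizer
state on `m` qubits. Operational Gottesman–Knill argument: the conjugated stabilizers
`h̃_i = W Z_i W⁻¹` of `Φ = W|0^{m+1}⟩` have no `X/Y` on the last qubit, hence restrict to commuting
signed Pauli involutions `h_i` on `m` qubits fixing `Φ(·,0)`; the common fixed space is the line of
`Φ(·,0)` (transport back to `|0^{m+1}⟩` through `W⁻¹`), and it contains the nonzero scaled stabilizer
state `∏ (1 + h_i)|z⟩` for a suitable basis state `z`. [Aaronson–Gottesman 2004, §III;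
Nielsen–Chuang 2010, §10.5.3] [folklore] -/
theorem exists_smul_stabilizer_projZ_of_vanishing {Φ : QReg (m + 1) → ℂ} (hΦ : Φ ∈ stabilizerStates (m + 1))
    (hΦ1 : ∀ x, Φ (Fin.append x fun _ => true) = 0) :
    ∃ (c : ℂ) (Φ' : QReg m → ℂ), Φ' ∈ stabilizerStates m ∧ projZ 1 Φ = c • Φ' := by
  classical
  obtain ⟨W, hW, hΦW⟩ := hΦ
  obtain ⟨W', _, hl, hr⟩ := exists_inverse_of_mem_cliffordCircuits hW
  have hΦne : Φ ≠ 0 := hΦW ▸ mulVec_zeroState_ne_zero hW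
  -- Heisenberg images of the single-qubit `Z`'s
  have hstab : ∀ i : Fin (m + 1), ∃ (k : ℕ) (a b : QReg (m + 1)),
      W * pauliOp (fun _ => false) (Pi.single i true) = (Complex.I ^ k • pauliOp a b) * W := fun i => by
    obtain ⟨k, a, b, e⟩ := (pushesPauli_and_pullsPauli_of_mem hW).1 0 (fun _ => false) (Pi.single i true)
    exact ⟨k, a, b, by rwa [pow_zero, one_smul] at e⟩
  choose k a b hk using hstab
  obtain ⟨hT, hhT⟩ : ∃ hT : Fin (m + 1) → Matrix (QReg (m + 1)) (QReg (m + 1)) ℂ,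
      ∀ i, hT i = Complex.I ^ k i • pauliOp (a i) (b i) := ⟨_, fun _ => rfl⟩
  -- blocks
  obtain ⟨aI, haI⟩ : ∃ aI : Fin (m + 1) → QReg m, ∀ i, aI i = fun l => a i (Fin.castAdd 1 l) := ⟨_, fun _ => rfl⟩
  obtain ⟨aL, haL⟩ : ∃ aL : Fin (m + 1) → QReg 1, ∀ i, aL i = fun j => a i (Fin.natAdd m j) := ⟨_, fun _ => rfl⟩
  obtain ⟨bI, hbI⟩ : ∃ bI : Fin (m + 1) → QReg m, ∀ i, bI i = fun l => b i (Fin.castAdd 1 l) := ⟨_, fun _ => rfl⟩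
  obtain ⟨bL, hbL⟩ : ∃ bL : Fin (m + 1) → QReg 1, ∀ i, bL i = fun j => b i (Fin.natAdd m j) := ⟨_, fun _ => rfl⟩
  have ha_eq : ∀ i, a i = Fin.append (aI i) (aL i) := fun i => by
    rw [haI, haL]; exact Fin.append_castAdd_natAdd.symm
  have hb_eq : ∀ i, b i = Fin.append (bI i) (bL i) := fun i => by
    rw [hbI, hbL]; exact Fin.append_castAdd_natAdd.symm
  obtain ⟨hI, hhI⟩ : ∃ hI : Fin (m + 1) → Matrix (QReg m) (QReg m) ℂ,
      ∀ i, hI i = Complex.I ^ k i • pauliOp (aI i) (bI i) := ⟨_, fun _ => rfl⟩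
  -- (1) the `h̃_i` fix `Φ`
  have hfix : ∀ i, hT i *ᵥ Φ = Φ := fun i => by
    rw [hhT, hΦW, Matrix.mulVec_mulVec, ← hk i, ← Matrix.mulVec_mulVec]
    congr 1
    rw [zeroState, pauliOp_mulVec_basisState, bxor_zero, sgn_single_left]
    simp
  -- (2) no `X` on the last qubit
  have haL0 : ∀ i, aL i = fun _ => false := fun i => by
    by_contra hne
    have hone : aL i = fun _ => true := by
      have e : aL i = fun _ => aL i 0 := funext fun j => by rw [Subsingleton.elim j 0]
      rw [e] at hne ⊢
      rcases Bool.eq_false_or_eq_true (aL i 0) with h | h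
      · rw [h]
      · exact absurd (by rw [h]) hne
    refine hΦne (eq_zero_of_append_vanishing (fun x => ?_) hΦ1)
    have e := congrFun (hfix i) (Fin.append x fun _ => false)
    rw [hhT, ha_eq, hb_eq, signedPauli_mulVec_apply_append, hone, zero_bxor, hΦ1, mul_zero] at e
    exact e.symm
  -- (3) intertwining with `Θ ↦ Θ ⊗ |0⟩`
  have hinter : ∀ i (Θ : QReg m → ℂ),
      hT i *ᵥ tensorVec Θ (zeroState 1) = tensorVec (hI i *ᵥ Θ) (zeroState 1) := fun i Θ => by
    funext z
    obtain ⟨x, y, rfl⟩ := exists_eq_append z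
    rw [hhT, hhI, ha_eq i, hb_eq i, signedPauli_mulVec_apply_append, haL0 i, bxor_zero, tensorVec_append,
      tensorVec_append, Matrix.smul_mulVec, Pi.smul_apply, smul_eq_mul, pauliOp_mulVec_apply]
    by_cases hy : y = fun _ => false
    · rw [hy, sgn_zero_right]; ring
    · rw [zeroState, basisState_apply, if_neg hy]; ring
  -- (4) conjugate representation: commuting involutions
  have hconj : ∀ i, hT i = W * pauliOp (fun _ => false) (Pi.single i true) * W' := fun i => by
    rw [hk i, Matrix.mul_assoc, hr, Matrix.mul_one, hhT]
  have hsandwich : ∀ P Q : Matrix (QReg (m + 1)) (QReg (m + 1)) ℂ,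
      W * P * W' * (W * Q * W') = W * (P * Q) * W' := fun P Q => by
    simp only [← Matrix.mul_assoc]
    rw [Matrix.mul_assoc (W * P) W' W, hl, Matrix.mul_one]
  have hcommT : ∀ i j, hT i * hT j = hT j * hT i := fun i j => by
    rw [hconj i, hconj j, hsandwich, hsandwich, pauliOp_zero_mul_comm]
  have hsqT : ∀ i, hT i * hT i = 1 := fun i => by
    rw [hconj i, hsandwich, pauliOp_mul_self, sgn_single_left]
    simp [hr]
  have hlift : ∀ i j (v : QReg m → ℂ), hI i *ᵥ (hI j *ᵥ v) = projZ 1 ((hT i * hT j) *ᵥ tensorVec v (zeroState 1)) :=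
    fun i j v => by rw [← Matrix.mulVec_mulVec, hinter j, hinter i, projZ_tensorVec_zeroState]
  have hcomm : ∀ i j (v : QReg m → ℂ), hI i *ᵥ (hI j *ᵥ v) = hI j *ᵥ (hI i *ᵥ v) := fun i j v => by
    rw [hlift, hlift, hcommT]
  have hinvol : ∀ i (v : QReg m → ℂ), hI i *ᵥ (hI i *ᵥ v) = v := fun i v => by
    rw [hlift, hsqT, Matrix.one_mulVec, projZ_tensorVec_zeroState]
  -- (5) the restriction is a common fixed vector, and the common fixed space is its line
  have hΦemb : Φ = tensorVec (projZ 1 Φ) (zeroState 1) := eq_tensorVec_projZ_of_vanishing hΦ1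
  have hfix' : ∀ i, hI i *ᵥ projZ 1 Φ = projZ 1 Φ := fun i => by
    have e := hinter i (projZ 1 Φ)
    rw [← hΦemb, hfix i] at e
    rw [← projZ_tensorVec_zeroState (t := 1) (hI i *ᵥ projZ 1 Φ), ← e]
  have hne' : projZ 1 Φ ≠ 0 := fun h => hΦne (by
    rw [hΦemb, h]
    funext z
    rw [tensorVec_apply, Pi.zero_apply, Pi.zero_apply, zero_mul])
  have huniq : ∀ Θ : QReg m → ℂ, (∀ i, hI i *ᵥ Θ = Θ) → ∃ c : ℂ, Θ = c • projZ 1 Φ := fun Θ hΘ => by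
    obtain ⟨Ω, hΩ⟩ : ∃ Ω, Ω = W' *ᵥ tensorVec Θ (zeroState 1) := ⟨_, rfl⟩
    have hΩfix : ∀ i, pauliOp (fun _ => false) (Pi.single i true) *ᵥ Ω = Ω := fun i => by
      have e : pauliOp (fun _ => false) (Pi.single i true) * W' = W' * hT i := by
        rw [hconj i]
        simp only [← Matrix.mul_assoc]
        rw [hl, Matrix.one_mul]
      rw [hΩ, Matrix.mulVec_mulVec, e, ← Matrix.mulVec_mulVec, hinter i, hΘ i]
    refine ⟨Ω (fun _ => false), ?_⟩
    have e2 : tensorVec Θ (zeroState 1) = Ω (fun _ => false) • Φ := by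
      have e3 : tensorVec Θ (zeroState 1) = W *ᵥ Ω := by rw [hΩ, Matrix.mulVec_mulVec, hr, Matrix.one_mulVec]
      have hΩeq := eq_smul_zeroState_of_forall_pauliZ hΩfix
      rw [e3]
      conv_lhs => rw [hΩeq]
      rw [Matrix.mulVec_smul, ← hΦW]
    calc Θ = projZ 1 (tensorVec Θ (zeroState 1)) := (projZ_tensorVec_zeroState Θ).symm
      _ = Ω (fun _ => false) • projZ 1 Φ := by rw [e2, projZ_smul]
  -- (6) synthesis: `∏ (1 + h_i) |z⟩` is a nonzero scaled stabilizer state on that line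
  obtain ⟨L, hL⟩ : ∃ L : List (Fin (m + 1)), L = List.finRange (m + 1) := ⟨_, rfl⟩
  have hmemL : ∀ i, i ∈ L := fun i => hL ▸ List.mem_finRange i
  have hPP : projProd (L.map hI) *ᵥ projZ 1 Φ = (2 : ℂ) ^ L.length • projZ 1 Φ :=
    projProd_mulVec_of_fixed hI (projZ 1 Φ) L fun i _ => hfix' i
  have hPne : projProd (L.map hI) *ᵥ projZ 1 Φ ≠ 0 := by
    rw [hPP]; exact smul_ne_zero (pow_ne_zero _ two_ne_zero) hne'
  have hexp : projProd (L.map hI) *ᵥ projZ 1 Φ = ∑ z, projZ 1 Φ z • (projProd (L.map hI) *ᵥ basisState z) := by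
    conv_lhs => rw [eq_sum_smul_basisState (projZ 1 Φ)]
    rw [Matrix.mulVec_sum]
    simp_rw [Matrix.mulVec_smul]
  obtain ⟨z, _, hz⟩ := Finset.exists_ne_zero_of_sum_ne_zero (hexp ▸ hPne)
  have hPz : projProd (L.map hI) *ᵥ basisState z ≠ 0 := fun h => hz (by rw [h, smul_zero])
  obtain ⟨c, hc⟩ := huniq _ fun i => mulVec_projProd_of_mem hI hcomm hinvol L (basisState z) i (hmemL i)
  have hc0 : c ≠ 0 := fun h => hPz (by rw [hc, h, zero_smul])
  have hIeq : hI = fun i => Complex.I ^ k i • pauliOp (aI i) (bI i) := funext hhI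
  obtain ⟨d, Ψ, hΨ, hd⟩ := exists_smul_stabilizer_projProd k aI bI (basisState_mem_stabilizerStates z) L
  refine ⟨c⁻¹ * d, Ψ, hΨ, ?_⟩
  rw [← smul_smul, ← hd, ← hIeq, hc, smul_smul, inv_mul_cancel₀ hc0, one_smul]

end removal2

section removal3

variable {m : ℕ}

/-- **Removing a postselected qubit**: for a stabilizer state `Φ` on `m + 1` qubits,
`(1 ⊗ ⟨0|)Φ = x ↦ Φ(x,0)` is a scaled stabilizer state on `m` qubits (scale `0` allowed). First
project with `(1 + Z_{last})/2` (a Pauli projection, `exists_smul_stabilizer_of_pauliProj`), then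
apply the core case. [Aaronson–Gottesman 2004, §III; Bravyi et al. 2019, §2.3.1] [folklore] -/
theorem exists_smul_stabilizer_projZ_one {Φ : QReg (m + 1) → ℂ} (hΦ : Φ ∈ stabilizerStates (m + 1)) :
    ∃ (c : ℂ) (Φ' : QReg m → ℂ), Φ' ∈ stabilizerStates m ∧ projZ 1 Φ = c • Φ' := by
  obtain ⟨c₁, Φ₁, hΦ₁, e₁⟩ :=
    exists_smul_stabilizer_of_pauliProj hΦ 0 (fun _ => false) (Pi.single (Fin.natAdd m (0 : Fin 1)) true)
  rw [pow_zero, one_smul] at e₁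
  have hΘ : ∀ (x : QReg m) (β : Bool),
      (Φ + pauliOp (fun _ => false) (Pi.single (Fin.natAdd m (0 : Fin 1)) true) *ᵥ Φ) (Fin.append x fun _ => β) =
        (if β then 0 else 2) * Φ (Fin.append x fun _ => β) := fun x β => by
    rw [Pi.add_apply, pauliOp_mulVec_apply, bxor_zero, sgn_single_left, Fin.append_right]
    cases β
    · simp [two_mul]
    · simp
  by_cases hc : c₁ = 0
  · refine ⟨0, zeroState m, zeroState_mem_stabilizerStates m, ?_⟩
    funext x
    have e := hΘ x false
    rw [e₁, hc, zero_smul, Pi.zero_apply] at e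
    rw [zero_smul, Pi.zero_apply, projZ_apply]
    simpa using e.symm
  · have hΦ₁eq : Φ₁ = c₁⁻¹ • (Φ + pauliOp (fun _ => false) (Pi.single (Fin.natAdd m (0 : Fin 1)) true) *ᵥ Φ) := by
      rw [e₁, smul_smul, inv_mul_cancel₀ hc, one_smul]
    have hΦ₁van : ∀ x, Φ₁ (Fin.append x fun _ => true) = 0 := fun x => by
      rw [hΦ₁eq, Pi.smul_apply, hΘ, if_pos rfl, zero_mul, smul_zero]
    obtain ⟨c₂, Φ₂, hΦ₂, e₂⟩ := exists_smul_stabilizer_projZ_of_vanishing hΦ₁ hΦ₁van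
    refine ⟨2⁻¹ * c₁ * c₂, Φ₂, hΦ₂, ?_⟩
    funext x
    have ex := congrFun e₂ x
    rw [projZ_apply, hΦ₁eq, Pi.smul_apply, hΘ, Pi.smul_apply, smul_eq_mul, smul_eq_mul] at ex
    simp only [Bool.false_eq_true, if_false] at ex
    rw [projZ_apply, Pi.smul_apply, smul_eq_mul]
    calc Φ (Fin.append x fun _ => false) = 2⁻¹ * c₁ * (c₁⁻¹ * (2 * Φ (Fin.append x fun _ => false))) := by
          field_simp
      _ = 2⁻¹ * c₁ * c₂ * Φ₂ x := by rw [ex]; ring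

/-- Appending zero blocks in two steps. [folklore] -/
theorem append_zero_succ (t : ℕ) (x : QReg m) :
    (Fin.append x fun _ : Fin (t + 1) => false) =
      Fin.append (Fin.append x fun _ : Fin t => false) (fun _ : Fin 1 => false) := by
  have h0 : (fun _ : Fin (t + 1) => false) = Fin.append (fun _ : Fin t => false) (fun _ : Fin 1 => false) := by
    funext i
    refine Fin.addCases (fun l => ?_) (fun r => ?_) i
    · rw [Fin.append_left]
    · rw [Fin.append_right]
  rw [h0, Fin.append_assoc]
  funext i
  rw [Function.comp_apply]
  congr 1

/-- Restricting `t + 1` wires to `|0…0⟩` in two steps. [folklore] -/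
theorem projZ_succ (t : ℕ) (Φ : QReg (m + (t + 1)) → ℂ) :
    projZ (t + 1) Φ = projZ t (projZ 1 (Φ : QReg (m + t + 1) → ℂ)) := by
  funext x
  rw [projZ_apply, projZ_apply, projZ_apply, append_zero_succ]

/-- Restricting zero extra wires is the identity. [folklore] -/
theorem projZ_zero (Φ : QReg (m + 0) → ℂ) : projZ 0 Φ = Φ := by
  funext x
  rw [projZ_apply]
  congr 1
  funext i
  have hi : i = Fin.castAdd 0 ⟨i.1, by omega⟩ := Fin.ext rfl
  calc Fin.append x (fun _ => false) i = Fin.append x (fun _ => false) (Fin.castAdd 0 ⟨i.1, by omega⟩) := by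
        rw [← hi]
    _ = x ⟨i.1, by omega⟩ := Fin.append_left _ _ _
    _ = x i := congrArg x (Fin.ext rfl)

/-- **Removing `t` postselected qubits**: for a stabilizer state `Φ` on `m + t` qubits,
`(1 ⊗ ⟨0^t|)Φ` is a scaled stabilizer state on `m` qubits. [Bravyi et al. 2019, §2.3.1 ("apply
`1 ⊗ ⟨0^{⊗τ}|` … to each stabilizer state in the decomposition and renormalize")] [folklore] -/
theorem exists_smul_stabilizer_projZ :
    ∀ (t : ℕ) {Φ : QReg (m + t) → ℂ}, Φ ∈ stabilizerStates (m + t) →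
      ∃ (c : ℂ) (Φ' : QReg m → ℂ), Φ' ∈ stabilizerStates m ∧ projZ t Φ = c • Φ'
  | 0, Φ, hΦ => ⟨1, Φ, hΦ, by rw [projZ_zero, one_smul]⟩
  | t + 1, Φ, hΦ => by
    obtain ⟨c₁, Φ₁, hΦ₁, e₁⟩ := exists_smul_stabilizer_projZ_one (m := m + t) hΦ
    obtain ⟨c₂, Φ₂, hΦ₂, e₂⟩ := exists_smul_stabilizer_projZ t hΦ₁
    refine ⟨c₁ * c₂, Φ₂, hΦ₂, ?_⟩
    rw [projZ_succ, e₁, projZ_smul, e₂, smul_smul]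

end removal3

/-! ### The magic-state gadget for a `T` gate -/

section gadget

variable {M : ℕ}

/-- The single-wire embedding of a wire of the first block. [folklore] -/
theorem wireEmb_trans_castAddEmb (q : Fin M) (t : ℕ) :
    (wireEmb q).trans (Fin.castAddEmb t) = wireEmb (Fin.castAdd t q) := by
  ext i; rfl

/-- Associativity of the tree's tensor product against a one-qubit third factor
(`(N + t) + 1 = N + (t + 1)` definitionally). [Nielsen–Chuang 2010, §2.1.7] [folklore] -/
theorem tensorVec_tensorVec_one {a b : ℕ} (ψ : QReg a → ℂ) (φ : QReg b → ℂ) (σ : QReg 1 → ℂ) :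
    tensorVec (tensorVec ψ φ) σ = tensorVec ψ (tensorVec φ σ) := by
  funext z
  rw [tensorVec_apply, tensorVec_apply, tensorVec_apply, tensorVec_apply, mul_assoc]
  have h1 : (fun i => z (Fin.castAdd 1 (Fin.castAdd b i))) = fun i => z (Fin.castAdd (b + 1) i) :=
    funext fun i => congrArg z (Fin.ext rfl)
  have h2 : (fun j => z (Fin.castAdd 1 (Fin.natAdd a j))) = fun j => z (Fin.natAdd a (Fin.castAdd 1 j)) :=
    funext fun j => congrArg z (Fin.ext rfl)
  have h3 : (fun l => z (Fin.natAdd (a + b) l)) = fun l => z (Fin.natAdd a (Fin.natAdd b l)) :=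
    funext fun l => congrArg z (Fin.ext (by simp only [Fin.val_natAdd]; omega))
  rw [h1, h2, h3]

/-- Updating a wire of the second block of an appended label. [folklore] -/
theorem update_append_natAdd {m t : ℕ} (x : QReg m) (y : QReg t) (j : Fin t) (β : Bool) :
    Function.update (Fin.append x y) (Fin.natAdd m j) β = Fin.append x (Function.update y j β) := by
  funext i
  refine Fin.addCases (fun l => ?_) (fun r => ?_) i
  · rw [Function.update_of_ne (fun h : Fin.castAdd t l = Fin.natAdd m j => natAdd_not_mem_range_castAddEmb j ⟨l, h⟩),
      Fin.append_left, Fin.append_left]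
  · rw [Fin.append_right]
    by_cases hr : r = j
    · subst hr
      rw [Function.update_self, Function.update_self]
    · rw [Function.update_of_ne (fun h : Fin.natAdd m r = Fin.natAdd m j => hr (Fin.natAdd_injective t m h)),
        Fin.append_right, Function.update_of_ne hr]

/-- The control wire (in the first block) and the magic wire (the last one) differ. [folklore] -/
theorem castAdd_one_ne_natAdd (q : Fin M) : Fin.castAdd 1 q ≠ Fin.natAdd M (0 : Fin 1) := fun h => by
  have h1 := congrArg Fin.val h
  have h2 := q.isLt
  simp at h1
  omega

/-- The `T` gate on a wire, in the Schrödinger picture: `(T_q Ψ)(x) = ω^{x_q} Ψ(x)`.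
[Nielsen–Chuang 2010, §4.2] [folklore] -/
theorem placeGate_tGate_mulVec_apply (q : Fin M) (Ψ : QReg M → ℂ) (x : QReg M) :
    (placeGate (wireEmb q) tGate *ᵥ Ψ) x = (if x q then omega else 1) * Ψ x := by
  rw [LightCone.placeGate_wireEmb_mulVec_apply]
  cases hx : x q
  · have h1 : Function.update x q false = x := by rw [← hx, Function.update_eq_self]
    simp [tGate, funext_iff, h1]
  · have h1 : Function.update x q true = x := by rw [← hx, Function.update_eq_self]
    simp [tGate, funext_iff, h1]

/-- **The magic-state gadget** (state injection with postselection): for any `M`-qubit vector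
`Ψ` and wire `q`, `(1 ⊗ ⟨0|) CNOT_{q → a} (Ψ ⊗ |T⟩_a) = T_q Ψ / √2` — eq. (15) of Bravyi et al.
2019 (`V|ψ⟩ = 2^{t/2}(1 ⊗ ⟨0^t|) C' |ψ⟩|V⟩`, `C' = ∏ CNOT_{a,a+t}`) for `V = T`, `t = 1`.
[Zhou–Leung–Chuang 2000; Bravyi–Gosset 2016, §II] [cite: BravyiEtAl2019, §2.3.1 eq. (15)] -/
theorem projZ_cnot_mulVec_tensorVec_magicT (q : Fin M) (Ψ : QReg M → ℂ) :
    projZ 1 (placeGate (pairEmb (Fin.castAdd 1 q) (Fin.natAdd M 0) (castAdd_one_ne_natAdd q)) cnot *ᵥ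
        tensorVec Ψ magicT) =
      invSqrt2 • (placeGate (wireEmb q) tGate *ᵥ Ψ) := by
  have hπ : Function.Involutive fun w : QReg (M + 1) =>
      Function.update w (Fin.natAdd M 0) (w (Fin.natAdd M 0) ^^ w (Fin.castAdd 1 q)) := by
    intro w
    dsimp only
    funext l
    by_cases hl : l = Fin.natAdd M 0
    · subst hl
      simp [Function.update_of_ne (castAdd_one_ne_natAdd q)]
    · simp [Function.update_of_ne hl]
  funext x
  rw [projZ_apply, ← cnotOn_toMatrix 0,
    LightCone.mulVec_apply_of_perm hπ (fun w => cnotOn_mulVec_basisState 0 _ _ (castAdd_one_ne_natAdd q) w),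
    Fin.append_right, Fin.append_left, Bool.false_xor, update_append_natAdd, tensorVec_append, Pi.smul_apply,
    smul_eq_mul, placeGate_tGate_mulVec_apply, CliffordSim.magicT_apply]
  have h0 : Function.update (fun _ : Fin 1 => false) 0 (x q) = fun _ => x q :=
    funext fun j => by rw [Subsingleton.elim j 0, Function.update_self]
  rw [h0]
  ring

end gadget

/-! ### Gadgetization of a Clifford+`T` circuit -/

section gadgetize

variable {N : ℕ}

/-- `|T⟩^{⊗0}` as the second factor: `(1 ⊗ ⟨∅|)(ψ ⊗ 1) = ψ`. [folklore] -/
theorem projZ_zero_tensorVec_tensorPow_zero (ψ : QReg N → ℂ) : projZ 0 (tensorVec ψ (tensorPow magicT 0)) = ψ := by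
  rw [projZ_zero]
  funext x
  rw [tensorVec_apply, tensorPow, mul_one]
  exact congrArg ψ (funext fun i => congrArg x (Fin.ext rfl))

/-- A placed Clifford gate of a Clifford+`T` circuit is a Clifford circuit. [folklore] -/
theorem toMatrix_gate_mem_cliffordCircuits (A : Language Bool) :
    ∀ (g : CliffordTOp) (e : Fin (cliffordT.arity g) ↪ Fin N), g ≠ CliffordTOp.T →
      (QGate.gate g e : QGate cliffordT N).toMatrix A ∈ cliffordCircuits N
  | .H, e, _ => Submonoid.subset_closure ⟨CliffordOp.H, e, rfl⟩
  | .S, e, _ => Submonoid.subset_closure ⟨CliffordOp.S, e, rfl⟩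
  | .T, _, h => absurd rfl h
  | .CNOT, e, _ => Submonoid.subset_closure ⟨CliffordOp.CNOT, e, rfl⟩

/-- One Clifford gate more: `C ↦ C · (G ⊗ 1)`. [Bravyi et al. 2019, §2.3.1] [folklore] -/
theorem gadgetize_clifford_step {t : ℕ} {G : Matrix (QReg N) (QReg N) ℂ}
    (hG : G ∈ cliffordCircuits N) {c : ℂ} {C : Matrix (QReg (N + t)) (QReg (N + t)) ℂ}
    (hC : C ∈ cliffordCircuits (N + t)) {V : Matrix (QReg N) (QReg N) ℂ}
    (hV : ∀ ψ : QReg N → ℂ, V *ᵥ ψ = c • projZ t (C *ᵥ tensorVec ψ (tensorPow magicT t))) :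
    ∃ C' ∈ cliffordCircuits (N + t),
      ∀ ψ : QReg N → ℂ, (V * G) *ᵥ ψ = c • projZ t (C' *ᵥ tensorVec ψ (tensorPow magicT t)) := by
  refine ⟨C * placeGate (Fin.castAddEmb t) G, Submonoid.mul_mem _ hC (placeGate_mem_cliffordCircuits _ hG),
    fun ψ => ?_⟩
  rw [← Matrix.mulVec_mulVec, hV, ← Matrix.mulVec_mulVec, placeGate_castAddEmb_mulVec_tensorVec]

/-- The successor tensor power, definitionally. [folklore] -/
theorem tensorPow_succ_eq (ψ : QReg 1 → ℂ) (k : ℕ) : tensorPow ψ (k + 1) = tensorVec (tensorPow ψ k) ψ := rfl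

/-- One `T` gate more: a fresh magic wire, a `CNOT` gadget, and `C ↦ (C ⊗ 1) · CNOT`.
[Bravyi et al. 2019, §2.3.1 eqs. (15)–(16)] [folklore] -/
theorem gadgetize_T_step {t : ℕ} (q : Fin N) {c : ℂ} {C : Matrix (QReg (N + t)) (QReg (N + t)) ℂ}
    (hC : C ∈ cliffordCircuits (N + t)) {V : Matrix (QReg N) (QReg N) ℂ}
    (hV : ∀ ψ : QReg N → ℂ, V *ᵥ ψ = c • projZ t (C *ᵥ tensorVec ψ (tensorPow magicT t))) :
    ∃ C' ∈ cliffordCircuits (N + (t + 1)),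
      ∀ ψ : QReg N → ℂ, (V * placeGate (wireEmb q) tGate) *ᵥ ψ =
        (c * invSqrt2⁻¹) • projZ (t + 1) (C' *ᵥ tensorVec ψ (tensorPow magicT (t + 1))) := by
  have hne := castAdd_one_ne_natAdd (Fin.castAdd t q)
  refine ⟨placeGate (Fin.castAddEmb 1) C *
      placeGate (pairEmb (Fin.castAdd 1 (Fin.castAdd t q)) (Fin.natAdd (N + t) 0) hne) cnot,
    Submonoid.mul_mem _ (placeGate_mem_cliffordCircuits _ hC) (placeGate_cnot_mem _ _ hne), fun ψ => ?_⟩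
  have hgad := projZ_cnot_mulVec_tensorVec_magicT (Fin.castAdd t q) (tensorVec ψ (tensorPow magicT t))
  rw [tensorVec_tensorVec_one, ← wireEmb_trans_castAddEmb, ← placeGate_placeGate,
    placeGate_castAddEmb_mulVec_tensorVec] at hgad
  have hgad' : tensorVec (placeGate (wireEmb q) tGate *ᵥ ψ) (tensorPow magicT t) =
      invSqrt2⁻¹ • projZ 1 (placeGate (pairEmb (Fin.castAdd 1 (Fin.castAdd t q)) (Fin.natAdd (N + t) 0) hne) cnot *ᵥ
        tensorVec (a := N) (b := t + 1) ψ (tensorPow magicT (t + 1))) := by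
    rw [tensorPow_succ_eq, hgad, smul_smul, inv_mul_cancel₀ invSqrt2_ne_zero, one_smul]
  rw [← Matrix.mulVec_mulVec, hV, hgad', Matrix.mulVec_smul, projZ_smul, smul_smul, projZ_succ t,
    ← Matrix.mulVec_mulVec, projZ_placeGate_castAddEmb_mulVec]

/-- **Gadgetization** (Bravyi et al. 2019, §2.3.1 eq. (16); Bravyi–Gosset 2016, §II): for an
oracle-free Clifford+`T` gate list with `t` `T`-gates there are a scalar `c` (namely `2^{t/2}`) and a
Clifford circuit `C` on `N + t` wires with `U ψ = c · (1 ⊗ ⟨0^t|) C (ψ ⊗ |T⟩^{⊗t})` for every input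
vector `ψ`. [cite: BravyiEtAl2019, §2.3.1 eq. (16)] -/
theorem gadgetize (A : Language Bool) :
    ∀ (L : List (QGate cliffordT N)), (∀ g ∈ L, g.IsOracleFree) → ∀ t : ℕ,
      (⟨L⟩ : QCircuit cliffordT N).tCount = t →
        ∃ (c : ℂ) (C : Matrix (QReg (N + t)) (QReg (N + t)) ℂ), C ∈ cliffordCircuits (N + t) ∧
          ∀ ψ : QReg N → ℂ, (⟨L⟩ : QCircuit cliffordT N).toMatrix A *ᵥ ψ =
            c • projZ t (C *ᵥ tensorVec ψ (tensorPow magicT t))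
  | [], _, t, ht => by
    rw [QCircuit.tCount_nil] at ht
    subst ht
    refine ⟨1, 1, Submonoid.one_mem _, fun ψ => ?_⟩
    rw [QCircuit.toMatrix_nil, Matrix.one_mulVec, Matrix.one_mulVec, one_smul, projZ_zero_tensorVec_tensorPow_zero]
  | QGate.oracle k e :: L, hof, t, _ => absurd (hof _ List.mem_cons_self) id
  | QGate.gate g e :: L, hof, t, ht => by
    have hofL : ∀ g' ∈ L, QGate.IsOracleFree g' := fun g' hg' => hof g' (List.mem_cons_of_mem _ hg')
    rw [QCircuit.tCount_cons] at ht
    cases g with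
    | T =>
      rw [QGate.isT_gate_T, if_pos rfl] at ht
      subst ht
      obtain ⟨c, C, hC, hV⟩ := gadgetize A L hofL _ rfl
      obtain ⟨C', hC', hV'⟩ := gadgetize_T_step (embT e 0) hC hV
      refine ⟨c * invSqrt2⁻¹, C', hC', fun ψ => ?_⟩
      rw [QCircuit.toMatrix_cons, QGate.toMatrix_gate, ← hV' ψ]
      congr 2
      exact congrArg (fun f : Fin 1 ↪ Fin N => placeGate f tGate) (emb_one_eq_wireEmb (embT e))
    | H =>
      rw [QGate.isT_gate_H] at ht
      simp only [Bool.false_eq_true, if_false, add_zero] at ht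
      obtain ⟨c, C, hC, hV⟩ := gadgetize A L hofL t ht
      obtain ⟨C', hC', hV'⟩ := gadgetize_clifford_step
        (toMatrix_gate_mem_cliffordCircuits A CliffordTOp.H e (by decide)) hC hV
      exact ⟨c, C', hC', fun ψ => by rw [QCircuit.toMatrix_cons, hV']⟩
    | S =>
      rw [QGate.isT_gate_S] at ht
      simp only [Bool.false_eq_true, if_false, add_zero] at ht
      obtain ⟨c, C, hC, hV⟩ := gadgetize A L hofL t ht
      obtain ⟨C', hC', hV'⟩ := gadgetize_clifford_step
        (toMatrix_gate_mem_cliffordCircuits A CliffordTOp.S e (by decide)) hC hV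
      exact ⟨c, C', hC', fun ψ => by rw [QCircuit.toMatrix_cons, hV']⟩
    | CNOT =>
      rw [QGate.isT_gate_CNOT] at ht
      simp only [Bool.false_eq_true, if_false, add_zero] at ht
      obtain ⟨c, C, hC, hV⟩ := gadgetize A L hofL t ht
      obtain ⟨C', hC', hV'⟩ := gadgetize_clifford_step
        (toMatrix_gate_mem_cliffordCircuits A CliffordTOp.CNOT e (by decide)) hC hV
      exact ⟨c, C', hC', fun ψ => by rw [QCircuit.toMatrix_cons, hV']⟩

/-- Linearity of `ψ ⊗ ·` on finite combinations. [folklore] -/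
theorem tensorVec_sum_smul_right {t r : ℕ} (ψ : QReg N → ℂ) (c : Fin r → ℂ) (φ : Fin r → QReg t → ℂ) :
    tensorVec ψ (∑ i, c i • φ i) = ∑ i, c i • tensorVec ψ (φ i) := by
  funext z
  simp only [tensorVec_apply, Finset.sum_apply, Pi.smul_apply, smul_eq_mul, Finset.mul_sum]
  refine Finset.sum_congr rfl fun i _ => ?_
  ring

end gadgetize

end StabilizerFormalism

open StabilizerFormalism

/-! ### The discharge -/

/-- **Discharge of `BravyiGosset2016_stabilizerRank_output_le`** — the gadgetization bound
`χ(U|y⟩) ≤ χ(|T⟩^{⊗t})` for an oracle-free Clifford+`T` circuit `U` with `t` `T`-gates and a basis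
state `|y⟩` (Bravyi–Browne–Calpin–Campbell–Gosset–Howard 2019, §2.3.1, eqs. (15)–(16): "starting
from an exact stabilizer decomposition of `|Ψ⟩`, we can apply `(1 ⊗ ⟨0^{⊗τ}|) C` to each stabilizer
state in the decomposition and renormalize to obtain an exact stabilizer decomposition of the
output state"; Bravyi–Gosset 2016, §II). Proof: `gadgetize` writes
`U|y⟩ = c (1 ⊗ ⟨0^t|) C (|y⟩ ⊗ |T⟩^{⊗t})` with `C` Clifford; insert a rank-`χ` stabilizer
decomposition of `|T⟩^{⊗t}` (`exists_stabilizerDecomposition`); each `|y⟩ ⊗ φᵢ` is a stabilizer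
state, `C` preserves stabilizer states, and `(1 ⊗ ⟨0^t|)` maps them to scaled stabilizer states
(`exists_smul_stabilizer_projZ`, the Gottesman–Knill postselection rule proved above).
[cite: BravyiEtAl2019, §2.3.1 eq. (16)] -/
theorem BravyiGosset2016_stabilizerRank_output_le_holds : BravyiGosset2016_stabilizerRank_output_le := by
  intro N U hU A y
  obtain ⟨c, C, hC, hUC⟩ := gadgetize A U.gates hU U.tCount rfl
  obtain ⟨cs, φs, hφs, hdec⟩ := exists_stabilizerDecomposition (tensorPow magicT U.tCount)
  have key : ∀ i, ∃ (d : ℂ) (φ' : QReg N → ℂ), φ' ∈ stabilizerStates N ∧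
      projZ U.tCount (C *ᵥ tensorVec (basisState y) (φs i)) = d • φ' := fun i =>
    exists_smul_stabilizer_projZ U.tCount (mulVec_mem_stabilizerStates hC
      (tensorVec_mem_stabilizerStates (basisState_mem_stabilizerStates y) (hφs i)))
  choose d φ' hφ' hd using key
  have hdec' : tensorVec (basisState y) (tensorPow magicT U.tCount) =
      ∑ i, cs i • tensorVec (basisState y) (φs i) := by
    rw [← tensorVec_sum_smul_right]
    exact congrArg (tensorVec (basisState y)) hdec
  refine (stabilizerRank_le_card (fun i => c * (cs i * d i)) φ' hφ' ?_).trans (by simp)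
  rw [show U.toMatrix A = (⟨U.gates⟩ : QCircuit cliffordT N).toMatrix A from rfl, hUC, hdec',
    Matrix.mulVec_sum, projZ_sum, Finset.smul_sum]
  refine Finset.sum_congr rfl fun i _ => ?_
  rw [Matrix.mulVec_smul, projZ_smul, hd, smul_smul, smul_smul, mul_assoc]

end Literature.Computability.QuantumComplexity
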